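import Mathlib
import Literature.Geometry.Lorentzian.GiorgiKlainermanSzeftel2022.GRWTransformationAlgebra

/-!
# Giorgi–Klainerman–Szeftel, *Wave equations estimates and the nonlinear stability of slowly rotating Kerr black holes*,
# Appendix D.4.3, Step 3 ("Reality of the potential and lower order terms": Proposition D.4.5, Lemma D.4.6) and the frame
# identity behind `L_𝔮` at the end of the proof of Theorem D.4.7 — the reality ledger of the Chandrasekhar transformation

CITATION HEADER.
* `[J]` = the journal version, Pure Appl. Math. Q. **20** (2024), no. 7, doi:10.4310/pamq.241128023033 (bib key
  `GiorgiKlainermanSzeftel2024`).  LOCATOR CONVENTION: `[J] p.N Lm` is line `m` of FILE page `N` of the per-page text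
  layer of that PDF (`lit read doi:10.4310/pamq.241128023033 --pages N`), i.e. printed folio `N − 1` — the convention of
  the sibling `ZCoefficientLedger` (`GRWTransformationAlgebra` quotes printed folios instead; where a display is cited
  there and here the two locators differ by one for this reason only).
* `[v1]` = arXiv:2205.14808v1, TeX source `FinalKerrarxivversion.tex` (bib key `GiorgiKlainermanSzeftel2022`); a
  locator `[v1] l.N` is a TeX line number.
* Numbering.  `[v1]` Proposition `prop:potential-real` (= `prop:lot-real`, `lemma-lot`) / Lemma `lemma:squaref-1f` /
  (`eq:condition-on-Im-V`) / (`eq:condition-on-Im-Za3`) are `[J]` Proposition D.4.5 / Lemma D.4.6 / (D.4.19) / (D.4.20);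
  `[v1]` Theorem `main-theorem-intermediate` / (`finalchoicefordefinition-C`) / (`wave-equation-qf-intermediate`) are
  `[J]` Theorem D.4.7 / (D.4.21) / (D.4.22); `[v1]` (`eq:expression-I33`) / (`eq:J33-final`) / (`eq:expression-K33`) /
  (`eq:expression-M33`) are `[J]` (D.4.9) / (D.4.10) / (D.4.12) / (D.4.13); `[v1]` (`eq:first-assumptions-C1-C2`) /
  (`definition-tilde-V`) / (`definition-V-final`) are `[J]` (D.4.3) / (D.4.15) / (D.4.18); the four labelled lines
  `[v1]` (`eq:vanishing-trch-atrch`), (`eq:vanishing-eta2-etab2`), (`eq:vanishing-div-eta-etab`),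
  (`eq:vanishing-div-dual-eta-etab`) are the four lines of `[J]` (3.4.2); `[v1]` Lemma `lemma:additional-relations-Kerr`
  / (`eq:vanishing-relations-Kerr`) / (`eq:vanishing-relations-Kerr-real`) / (`eq:vanishing-relations-Kerr-real-2`) are
  `[J]` Lemma 3.4.5 / (3.4.7) / (3.4.8) / (3.4.10); `[v1]` Lemma `lemma:definition-conformal-derivatives` / Proposition
  `prop-nullstr-conformal` = `[J]` Lemma 2.2.17 / Proposition 2.2.19; `[v1]` Definition `definition-hodge-duals` / Lemma
  `le:duals` / the wedge of real 1-forms (l.2759) = `[J]` Definition 2.1.7 / Lemma 2.1.10 / Definition 2.1.12; the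
  unlabelled lemma `[v1]` l.4882–4924 = `[J]` Lemma 2.4.4; `[v1]` Definition `def:complexRicciandcurvaturecoefficients` =
  `[J]` Definition 2.4.8; the canonical horizontal basis `[v1]` l.5491 = `[J]` (3.3.3); the outgoing principal null pair
  `[v1]` l.5683–5687 = `[J]` p.126 L67–95 with its Ricci table l.5735–5747 = p.127 L130–185; the ingoing table
  l.5554–5566 = p.124 L55–110.
* Glyphs.  The `[J]` text layer drops the under-bar accent (`tr χ` / `tr χ̲`, `η` / `η̲` print alike) and most large
  parentheses; every bar placement below was read on the `[v1]` TeX source, the `[J]` locus fixes the position of the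
  display.  The two texts agree display by display in the part of Appendix D transcribed here (checked line by line);
  the one divergence met, DV below, is in Chapter 3.

WHAT IS TRANSCRIBED (and nothing else).  Writing `x = tr χ`, `y = ⁽ᵃ⁾tr χ`, `xb = tr χ̲`, `yb = ⁽ᵃ⁾tr χ̲`, `ω`, `ω̲`, `ρ`,
`*ρ`, `η = (e1, e2)`, `η̲ = (b1, b2)`, and `C̃₁ = C_R + iC_I` for the perturbation in `C₁ = 2tr χ̲ + C̃₁` of (D.4.3):
* §0 conventions for real and complex horizontal 1-forms in components: `*`, `·`, `∧` (Definition 2.1.7, Lemma 2.1.10,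
  Definition 2.1.12) and the pairings `H · H̄ = 2|η|²`, `H · conj(H̲) = 2(η · η̲ − iη ∧ η̲)` (Lemma 2.4.4) — the dictionary
  by which the displayed real and imaginary parts below are read off;
* §1 Lemma D.4.6 (`[J]` p.852 L58–p.854 L31 = `[v1]` l.34852–34895): with the Lemma 4.7.5 values `∇₄f = (2tr χ + i⁽ᵃ⁾tr χ)f`,
  `∇₃f = (2tr χ̲ − i⁽ᵃ⁾tr χ̲)f`, `∇f = (2(η + η̲) + i(*η − *η̲))f` of `f = q q̄³` entered as hypotheses, the Leibniz
  expansion of `∇₄∇₃f` and its real/imaginary split, the split of `(2(η + η̲) + i(*η − *η̲))²`, and the displayed values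
  of `ℑ(f⁻¹□_g f)` and `ℜ(f⁻¹□_g f)` after substituting the null structure values of `∇₄tr χ̲`, `∇₄⁽ᵃ⁾tr χ̲`, `curl η̲`;
* §2 the real and imaginary parts of `I₃₃` (D.4.9), `J₃₃` (D.4.10), `K₃₃` (D.4.12) (the Proposition 2.2.19 values of
  `∇₃^(c)tr χ`, `∇₃^(c)⁽ᵃ⁾tr χ` as hypotheses), `M₃₃` (D.4.13) and of `Ṽ` (D.4.15) (`[J]` p.854 L32–44, p.855 L25–51);
* §3 the sums `ℑ(V̂)`, `ℑ(Ṽ)`, `ℑ(V₁) = ℑ(f⁻¹□_g f) + ℑ(Ṽ)` and the reduction to (D.4.19) modulo the (3.4.2) quantities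
  (p.854 L45–p.855 L24);
* §4 the sums `ℜ(V̂)`, `ℜ(Ṽ)`, `V₁ = ℜ(f⁻¹□_g f) + ℜ(Ṽ)` and its (3.4.2)-rewriting (p.855 L52–p.856 L10), whose output is
  the head of the left side of `GRWTransformationAlgebra.V1_regroup` — the explicit Kerr evaluation p.856 L11–p.857 L70
  is there (`V1_regroup`, `V1_kerr_values1/2`, `V1_chain`, `div_etab`, `curl_etab`, …);
* §5 `ℑ(Z₄₃) = ∇₃^(c)ℑ(C̃₁) + tr χ̲ ℑ(C̃₁)` and its factorisation for `ℑ(C̃₁) = n⁽ᵃ⁾tr χ̲` (p.857 L73–p.858 L16; the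
  `ℜ`-chain p.858 L17–64 is `GRWTransformationAlgebra.Z43_leibniz/Z43_algebra/Z43_kerr`);
* §6 `ℑ(Z_{a3})` (p.858 L68–p.859 L53): the imaginary parts of `I_{a3}`, `J_{a3}`, `L_{a3}`, `M_{a3}`, their sum, the Hodge
  dual of (3.4.8), condition (D.4.20) (also as an equivalence), and the four-line verification that `ℑ(C̃₁) = −4⁽ᵃ⁾tr χ̲`
  satisfies it via (3.4.10) and (3.4.8) — as linear identities in a `K`-module `V` of horizontal 1-forms with a Hodge map
  `st` (`st ∘ st = −1`) and `∇₃^(c)` a `GRWTransformationAlgebra.CovD`;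
* §7 `ℜ(Z_{a3})` (p.859 L55–p.861 L150): the real parts of `I, J, L, M`, the sum, the substitution of `∇₃^(c)η̲`
  (Proposition 2.2.19), (3.4.8), (3.4.10), the quotient rule for `∇^(c)(⁽ᵃ⁾tr χ̲²/tr χ̲)` (a `V`-valued derivation), the
  (3.4.10) substitution, the choice `ℜ(C̃₁) = −2⁽ᵃ⁾tr χ̲²/tr χ̲`, and the `e₁`/`e₂` evaluations giving `ℜ(Z₁₃)`, `ℜ(Z₂₃)` (the
  Kerr values `⁽ᵃ⁾tr χ̲/tr χ̲ = −a cos θ/r`, the `ℜ(Z₁₃)` bracket and `ℜ(Z₂₃) = 8a sin θ Δ/|q|⁵` are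
  `GRWTransformationAlgebra.atrchb_div_trchb_out/ReZ13_bracket/Z23_kerr`; here the `e₁`-expression of `ℜ(Z₁₃)` is in
  addition shown to vanish identically on the tables);
* §8 the Kerr provenance, on the exact tables of `GRWTransformationAlgebra`, of the relations entered above as
  hypotheses: (3.4.2) lines 3–4 (in the divergence model `div ξ = e₁(ξ₁) + Λξ₁` of p.857 L5–13), the `tr χ̲(η + η̲)`
  relation of (3.4.8) (outgoing and ingoing), (3.4.10) (`e₁`-components exact OUTGOING, `e₂`-components trivial; INGOING
  the two sides differ — DV below), the `⁽ᵃ⁾tr χ̲` twin of `ZCoefficientLedger.e3c_trchb_out`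
  (`∇₃^(c)⁽ᵃ⁾tr χ̲ = −tr χ̲⁽ᵃ⁾tr χ̲`), whence `ℑ(Z₄₃) = 0` exactly for `ℑ(C̃₁) = n⁽ᵃ⁾tr χ̲`, and (D.4.19) exactly for
  `ℑ(C̃₁) = −4⁽ᵃ⁾tr χ̲` (`ω = 0` in the outgoing normalization, p.127 L133);
* §9 the frame identity `½((Δ/(r² + a²))e₄ + (|q|²/(r² + a²))e₃) = T̂` (p.863 L32–52; = the `T̂`-decomposition of the
  outgoing pair, p.127 L5–40) and the collection of the `∂ₜ`, `∂ᵣ`, `∂_φ` coefficients of `Z₄₃((|q|²/Δ)e₃ + e₄) + Z₂₃e₂`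
  (p.863 L52–88), which `GRWTransformationAlgebra.Lq_coefficients` evaluates; `V = V₁ + (|q|²/Δ)Z₄₃` is
  `GRWTransformationAlgebra.V_eq_V1_add_Z43`.

WHAT IS CERTIFIED.  Identities in an arbitrary field `K` (of characteristic zero wherever a numeral is inverted; §0 in
any commutative ring; §6–§7 in any `K`-module `V`).  Complex scalars are handled through an element `i` with `i² = −1`
acting on explicitly split real and imaginary parts — an abstract field has no conjugation, so each line "`ℑ(·) = I`",
"`ℜ(·) = R`" is the statement that the displayed expression, built from `i`-free data, equals `R + iI` with the displayed
`R`, `I` (complex 1-forms: the two component pairs).  Frame derivatives act through derivations `Derivation ℤ K K` (resp.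
`Derivation ℤ K V` for the horizontal gradient in §7) killing `i` and the numerals, with the printed transport / null
structure values as explicit hypotheses; `∇₃^(c)` on 1-forms is additive with the Leibniz rule and nothing else (its
commutation with `st` is a hypothesis where used); conformal weights follow Lemma 2.2.17 (`tr χ̲`, `⁽ᵃ⁾tr χ̲`, `C₁`, `C̃₁`
are `(−1)`-conformal: `∇₄^(c) = ∇₄ − 2ω`, `∇₃^(c) = ∇₃ + 2ω̲`, `∇^(c) = ∇ − ζ`; `η`, `η̲`, `ρ`, `*ρ` are `0`-conformal).
Every `Γ_b`, `Γ_g`, `r⁻ᵖ𝔡^{≤1}Γ`, `O(·)`, "l.o.t." term is OUTSIDE the statements or carried as a named free remainder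
(`g`, `g1`, `r1`, `Q`, …) whose exact coefficient the theorem then displays; the theorems are the exact equalities of the
explicitly printed algebra.  Proofs are `simp`/`field_simp`/`ring`/`linear_combination`/`module`/`match_scalars`
computations.

PRINT DATA located while certifying: none — every transcribed display of Step 3 checks as printed, given the entered
values (the coefficient lists of p.854–p.856, (D.4.19), (D.4.20), the chains of p.859–p.861, the frame identity of
p.863).

DIVERGENCE `[v1]` → `[J]` (one, in Chapter 3, recorded because Step 3 leans on it).
* (DV) `[v1]` Lemma `lemma:additional-relations-Kerr` (l.6050) is stated "In Kerr, relative to any frame" and introduces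
  (`eq:vanishing-relations-Kerr-real-2`) = (3.4.10) with "We also have" (l.6073); `[J]` Lemma 3.4.5 (p.133 L65) keeps
  "relative to any frame" for (3.4.7)–(3.4.9) and introduces (3.4.10) with "We also have in the outgoing null frame"
  (p.133 L103).  The kernel sides with `[J]`: on the outgoing tables both lines of (3.4.10) hold exactly (`id3410_out_e1`,
  `id3410_e2`); on the ingoing tables (`tr χ̲ = −2r/|q|²`, `⁽ᵃ⁾tr χ̲ = 2a cos θ/|q|²`, the same `η`, `η̲`, p.124 L55–110) the
  `e₁`-components of the two sides differ by `4a²r cos θ sin θ/|q|⁵` and `−4a³cos²θ sin θ/|q|⁵` (`id3410_in_e1_gap`),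
  nonzero for `a ≠ 0`.  Appendix D uses (3.4.10) in the outgoing normalization (p.859 L20, p.860 L22, L102), consistent
  with `[J]`; NIL effect on Step 3.

NOT CLAIMED.  No statement about tensors, horizontal structures, the operators `□_g`, `□̇₂`, `L_𝔮`, or about Proposition
D.4.5 / Lemma D.4.6 / Theorem D.4.7 as assertions on spacetimes; the `Γ`/`O` bookkeeping (which terms are admissible
errors is the authors' and is not modelled); the `∇₃η` relation of (3.4.8), the `∇₃^(c)η̲` row of Proposition 2.2.19,
`[∇₃, *] = 0`, and the Lemma 4.7.5 values of `∇f` (p.181 L21–40) are hypotheses of the identities that use them, not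
certified; the regrouping "`2Z₄₃T∇₃ + ℜ(Z)·∇∇₃ = Z₄₃((|q|²/Δ)e₃ + e₄)∇₃ + Z₂₃e₂∇₃ + l.o.t.`" of p.863 L6–29 beyond the
frame identity and the coefficient collection of §9 (its `W`-terms absorb unprinted lower-order terms); D.5–D.7.

STATUS-RELATION.  Imports `GRWTransformationAlgebra` (module of `[J]` §3.3/§5.2–5.3/D.3–D.4.3) for the value tables
`nsq, Del, trchO, atrchO, trchbO, atrchbO, trchbI, atrchbI, ombO, srho, curlEtab, Lam, eta1, eta2, seta1, seta2, etab1,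
etab2, setab1, setab2`, the structure `CovD`, the helpers `D_num, sqpow, nsq_ne_zero_of_sq` and the theorems
`e4_atrchb_out, id342a_out`, BY NAME; nothing there or in `ZCoefficientLedger` (module of D.4.1–D.4.2, referred to by name
only) is restated or modified.  Division of Step 3 between the modules: the explicit Kerr evaluations (`V₁`, `ℜ(Z₄₃)`,
the `ℜ(Z₁₃)` bracket, `Z₂₃`, the `L_𝔮` coefficients, `V`) are `GRWTransformationAlgebra` §7; the generic real/imaginary
bookkeeping of Lemma D.4.6, `V̂`, `Ṽ`, (D.4.19), (D.4.20), `Z_{a3}` and the Kerr provenance of (3.4.2)₃,₄ / (3.4.8) /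
(3.4.10) are here.
-/

namespace Literature.Geometry.Lorentzian.GiorgiKlainermanSzeftel2022.PotentialRealityLedger

open Literature.Geometry.Lorentzian.GiorgiKlainermanSzeftel2022.GRWTransformationAlgebra

/-! ## §0. Conventions: components, Hodge dual, wedge, complexified pairings

Horizontal real 1-forms are written in the canonical basis `(e₁, e₂)` of `[J]` (3.3.3) as component pairs
`ξ = (ξ₁, ξ₂)`, with `*ξ = (ξ₂, −ξ₁)` (Definition 2.1.7, `*ξ_a = ∈_{ab}ξ_b`, `∈₁₂ = 1`), `ξ · η = ξ₁η₁ + ξ₂η₂`,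
`ξ ∧ η = ∈^{ab}ξ_aη_b = ξ · *η` (Definition 2.1.12), and a complex 1-form `F = f + i *f` has components
`(f₁ + i f₂, f₂ − i f₁)`.  Throughout: `η = (e1, e2)`, `η̲ = (b1, b2)`; scalars `x = tr χ`, `y = ⁽ᵃ⁾tr χ`, `xb = tr χ̲`,
`yb = ⁽ᵃ⁾tr χ̲`, `om = ω`, `rh = ρ`, `srh = *ρ`, `de = div η`, `deb = div η̲`, `dse = div *η = curl η`,
`dseb = div *η̲ = curl η̲` (Lemma 2.4.4: `∇ · *ξ = curl ξ`), `i` an element with `i² = −1`. -/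

section Components

variable {K : Type*} [CommRing K]

/-- Lemma 2.1.10 / Definition 2.1.12 in components: `*u · *v = u · v`, `u · *u = 0`, `u · *v = u ∧ v = u₁v₂ − u₂v₁`,
`*u · v = −u · *v`. [cite: GiorgiKlainermanSzeftel2024, Definition 2.1.7 p.67 L53–62, Lemma 2.1.10 p.68 L32–36, Definition 2.1.12 p.69 L10–13; GiorgiKlainermanSzeftel2022, l.2664–2670, l.2710–2715, l.2759] -/
theorem hodge_pairings (u1 u2 v1 v2 : K) :
    (u2 * v2 + (-u1) * (-v1) = u1 * v1 + u2 * v2) ∧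
    (u1 * u2 + u2 * (-u1) = 0) ∧
    (u1 * v2 + u2 * (-v1) = u1 * v2 - u2 * v1) ∧
    (u2 * v1 + (-u1) * v2 = -(u1 * v2 + u2 * (-v1))) := by
  refine ⟨by ring, by ring, by ring, by ring⟩

/-- Lemma 2.4.4 (first identity and its `η = ξ` case) in components, for `H = η + i*η`, `H̲ = η̲ + i*η̲`:
`H · H̄ = 2|η|²` and `H · conj(H̲) = 2(η · η̲ − i η ∧ η̲)`.
[cite: GiorgiKlainermanSzeftel2024, Lemma 2.4.4 p.110 L31–p.111 L17; GiorgiKlainermanSzeftel2022, l.4882–4910] -/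
theorem H_pairings (i e1 e2 b1 b2 : K) (hi : i ^ 2 = -1) :
    ((e1 + i * e2) * (e1 - i * e2) + (e2 - i * e1) * (e2 + i * e1) = 2 * (e1 ^ 2 + e2 ^ 2)) ∧
    ((e1 + i * e2) * (b1 - i * b2) + (e2 - i * e1) * (b2 + i * b1)
        = 2 * ((e1 * b1 + e2 * b2) - i * (e1 * b2 - e2 * b1))) := by
  constructor
  · linear_combination (-(e1 ^ 2 + e2 ^ 2)) * hi
  · linear_combination (-(e1 * b1 + e2 * b2)) * hi

end Components

/-! ## §1. Lemma D.4.6 (`[J]` p.852 L58 – p.854 L31 = `[v1]` l.34852–34895): `f⁻¹□_g f` for `f = q q̄³`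

The three first-derivative values `∇₃f = (2tr χ̲ − i⁽ᵃ⁾tr χ̲)f`, `∇₄f = (2tr χ + i⁽ᵃ⁾tr χ)f`,
`∇f = (2(η + η̲) + i(*η − *η̲))f` (p.853 L5–39) are `GRWTransformationAlgebra.lemmaD46_e3f/e4f/coeff3/coeff4/gradcoeff`
and are used here as hypotheses / entered values. -/

section LemmaD46

variable {K : Type*} [Field K] [CharZero K]

omit [CharZero K] in
/-- "we deduce `∇₄∇₃f = (2∇₄tr χ̲ − i∇₄⁽ᵃ⁾tr χ̲)f + (2tr χ̲ − i⁽ᵃ⁾tr χ̲)∇₄f = (…)f + (2tr χ̲ − i⁽ᵃ⁾tr χ̲)(2tr χ + i⁽ᵃ⁾tr χ)f`":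
the Leibniz rule for a derivation `D4` (the frame derivative `e₄` on scalars) with `D4 i = 0` and the entered value of
`∇₄f`. [cite: GiorgiKlainermanSzeftel2024, p.853 L40–50; GiorgiKlainermanSzeftel2022, l.34866–34868] -/
theorem D46_e4e3f (D4 : Derivation ℤ K K) (i f x y xb yb : K) (hDi : D4 i = 0)
    (hf : D4 f = (2 * x + i * y) * f) :
    D4 ((2 * xb - i * yb) * f)
      = (2 * D4 xb - i * D4 yb) * f + (2 * xb - i * yb) * ((2 * x + i * y) * f) := by
  obtain ⟨D2, -⟩ := D_num D4
  simp only [map_sub, D4.leibniz, hf, hDi, D2, smul_eq_mul, mul_zero, add_zero]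
  ring

omit [CharZero K] in
/-- Real and imaginary parts of `f⁻¹∇₄∇₃f = (2∇₄tr χ̲ − i∇₄⁽ᵃ⁾tr χ̲) + (2tr χ̲ − i⁽ᵃ⁾tr χ̲)(2tr χ + i⁽ᵃ⁾tr χ)`:
`ℜ = 2∇₄tr χ̲ + 4tr χ tr χ̲ + ⁽ᵃ⁾tr χ ⁽ᵃ⁾tr χ̲`, `ℑ = −∇₄⁽ᵃ⁾tr χ̲ + 2tr χ̲ ⁽ᵃ⁾tr χ − 2tr χ ⁽ᵃ⁾tr χ̲` — the terms
"`∇₄⁽ᵃ⁾tr χ̲ − 2tr χ̲⁽ᵃ⁾tr χ + 2tr χ⁽ᵃ⁾tr χ̲`" (p.853 L71) and "`−2∇₄tr χ̲ − 4tr χ tr χ̲ − ⁽ᵃ⁾tr χ⁽ᵃ⁾tr χ̲`" (p.854 L12) of the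
second lines of the two computations (each enters with the sign of `−f⁻¹∇₄∇₃f` in Lemma 4.7.5).
[cite: GiorgiKlainermanSzeftel2024, p.853 L60–75, p.854 L2–14; GiorgiKlainermanSzeftel2022, l.34876–34878, l.34886–34888] -/
theorem D46_e4e3f_parts (i x y xb yb d4xb d4yb : K) (hi : i ^ 2 = -1) :
    (2 * d4xb - i * d4yb) + (2 * xb - i * yb) * (2 * x + i * y)
      = (2 * d4xb + 4 * x * xb + y * yb) + i * (-d4yb + 2 * xb * y - 2 * x * yb) := by
  linear_combination (-(yb * y)) * hi

omit [CharZero K] in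
/-- "`Δf = (2div(η + η̲) + i div(*η − *η̲))f + (2(η + η̲) + i(*η − *η̲)) · ∇f`" with `∇f = (2(η + η̲) + i(*η − *η̲))f`: the
quadratic term `(2w + iv) · (2w + iv)` (`w = η + η̲ = (w1, w2)`, `v = *η − *η̲ = (v1, v2)`) has real part
`4|η + η̲|² − |*η − *η̲|²` (p.854 L17) and imaginary part `4(η + η̲) · (*η − *η̲)` (p.853 L80).
[cite: GiorgiKlainermanSzeftel2024, p.853 L51–58, L80, p.854 L17; GiorgiKlainermanSzeftel2022, l.34870–34872, l.34880, l.34889] -/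
theorem D46_lap_parts (i w1 w2 v1 v2 : K) (hi : i ^ 2 = -1) :
    (2 * w1 + i * v1) ^ 2 + (2 * w2 + i * v2) ^ 2
      = (4 * (w1 ^ 2 + w2 ^ 2) - (v1 ^ 2 + v2 ^ 2)) + i * (4 * (w1 * v1 + w2 * v2)) := by
  linear_combination (v1 ^ 2 + v2 ^ 2) * hi

/-- The imaginary part, second line → third line (p.853 L71–89 → p.854 L2): with "the null structure equation for
`∇₄⁽ᵃ⁾tr χ̲`" entered as the hypothesis `h4` — Proposition 2.2.19 (`∇₄^(c)⁽ᵃ⁾tr χ̲ = −½(⁽ᵃ⁾tr χ tr χ̲ + tr χ ⁽ᵃ⁾tr χ̲) +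
2curl^(c)η̲ + 2*ρ + [−χ̂ ∧ χ̲̂ + 2ξ ∧ ξ̲]`) combined with Lemma 2.2.17 (`∇₄ = ∇₄^(c) + 2ω` on the `(−1)`-conformal
`⁽ᵃ⁾tr χ̲`; `η̲` is `0`-conformal so `curl^(c)η̲ = curl η̲ = div *η̲`, Lemma 2.4.4), the bracket and all `Γ`-terms carried
in the free remainder `Q` —
`∇₄⁽ᵃ⁾tr χ̲ − 2tr χ̲⁽ᵃ⁾tr χ + 2tr χ⁽ᵃ⁾tr χ̲ − ½tr χ̲⁽ᵃ⁾tr χ − (2ω − ½tr χ)⁽ᵃ⁾tr χ̲ + div(*η − *η̲) + 4(η + η̲) · (*η − *η̲)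
+ 2η̲ · (*η − *η̲) = −3tr χ̲⁽ᵃ⁾tr χ + 2tr χ⁽ᵃ⁾tr χ̲ + 2*ρ + div(*η + *η̲) − 10 η ∧ η̲ (+Q)`
(components: `*η − *η̲ = (e2 − b2, −e1 + b1)`, `η ∧ η̲ = η · *η̲ = e1 b2 − e2 b1`; the `ω`-terms cancel).
[cite: GiorgiKlainermanSzeftel2024, p.853 L60–89, p.854 L2, Proposition 2.2.19 p.105 L77–79, Lemma 2.2.17 p.105 L7–11, Lemma 2.4.4 p.111 L17–31; GiorgiKlainermanSzeftel2022, l.34874–34883, l.4599–4600, l.4559–4568, l.4909–4921] -/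
theorem D46_Im (x y xb yb om srh cub dse dseb e1 e2 b1 b2 d4yb Q : K)
    (h4 : d4yb = -(1 / 2) * (y * xb + x * yb) + 2 * cub + 2 * srh + 2 * om * yb + Q) (hcurl : cub = dseb) :
    d4yb - 2 * xb * y + 2 * x * yb - 1 / 2 * xb * y - (2 * om - 1 / 2 * x) * yb + (dse - dseb)
        + 4 * ((e1 + b1) * (e2 - b2) + (e2 + b2) * (-e1 + b1)) + 2 * (b1 * (e2 - b2) + b2 * (-e1 + b1))
      = -3 * xb * y + 2 * x * yb + 2 * srh + (dse + dseb) - 10 * (e1 * b2 + e2 * (-b1)) + Q := by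
  subst h4 hcurl
  ring

/-- The real part, second line → third line (p.854 L2–31): with "the null structure equation for `∇₄tr χ̲`" entered as
`h4` — Proposition 2.2.19 (`∇₄^(c)tr χ̲ = −½tr χ tr χ̲ + ½⁽ᵃ⁾tr χ⁽ᵃ⁾tr χ̲ + 2div^(c)η̲ + 2|η̲|² + 2ρ + [−χ̂ · χ̲̂ + 2ξ · ξ̲]`)
with `∇₄ = ∇₄^(c) + 2ω` (Lemma 2.2.17, `s = −1`) and `div^(c)η̲ = div η̲`, bracket and `Γ`-terms in `Q` —
`−2∇₄tr χ̲ − 4tr χ tr χ̲ − ⁽ᵃ⁾tr χ⁽ᵃ⁾tr χ̲ − ½tr χ̲(2tr χ) + (2ω − ½tr χ)(2tr χ̲) + 2div(η + η̲) + 4|η + η̲|² − |*η − *η̲|²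
+ 2η̲ · (2(η + η̲)) = −5tr χ tr χ̲ − 2⁽ᵃ⁾tr χ⁽ᵃ⁾tr χ̲ − 4ρ + 2div(η − η̲) + 3(|η|² + |η̲|²) + 14 η · η̲ (−2Q)`.
[cite: GiorgiKlainermanSzeftel2024, p.854 L2–31, Proposition 2.2.19 p.105 L70–72, Lemma 2.2.17 p.105 L7–11; GiorgiKlainermanSzeftel2022, l.34884–34894, l.4597–4598, l.4559–4568] -/
theorem D46_Re (x y xb yb om rh de deb e1 e2 b1 b2 d4xb Q : K)
    (h4 : d4xb = -(1 / 2) * x * xb + 1 / 2 * y * yb + 2 * deb + 2 * (b1 ^ 2 + b2 ^ 2) + 2 * rh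
      + 2 * om * xb + Q) :
    -2 * d4xb - 4 * x * xb - y * yb - 1 / 2 * xb * (2 * x) + (2 * om - 1 / 2 * x) * (2 * xb) + 2 * (de + deb)
        + (4 * ((e1 + b1) ^ 2 + (e2 + b2) ^ 2) - ((e2 - b2) ^ 2 + (-e1 + b1) ^ 2))
        + 2 * (b1 * (2 * (e1 + b1)) + b2 * (2 * (e2 + b2)))
      = -5 * x * xb - 2 * y * yb - 4 * rh + 2 * (de - deb) + 3 * ((e1 ^ 2 + e2 ^ 2) + (b1 ^ 2 + b2 ^ 2))
        + 14 * (e1 * b1 + e2 * b2) - 2 * Q := by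
  subst h4
  ring

end LemmaD46

/-! ## §2. The pieces of `V̂ = I₃₃ + J₃₃ + K₃₃ + M₃₃` and of `Ṽ` split into real and imaginary parts
(`[J]` p.854 L32–44, p.855 L25–51 = `[v1]` l.34897–34911, l.34938–34952)

`C̃₁ = C_R + i C_I` (`C₁ = 2tr χ̲ + C̃₁`, (D.4.3)); `∇₄^(c)`, `∇₃^(c)` act on the scalars through derivations `D4`, `D3`
killing `i` (on the `(−1)`-conformal `C₁`, `∇₄^(c) = D4 − 2ω`, Lemma 2.2.17); `ne = |η|²`, `nb = |η̲|²`, `ee = η · η̲`,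
`w = η ∧ η̲`. -/

section Pieces

variable {K : Type*} [Field K] [CharZero K]

/-- (D.4.15) split: `Ṽ = [½tr χ tr χ̲ + ½⁽ᵃ⁾tr χ⁽ᵃ⁾tr χ̲ − 4ρ − 4η · η̲] + i[−tr χ⁽ᵃ⁾tr χ̲ + ⁽ᵃ⁾tr χ tr χ̲ + 4*ρ + 2η ∧ η̲] − V̂`
with `V̂ = V̂_R + i V̂_I`, i.e. "`ℑ(Ṽ) = −tr χ⁽ᵃ⁾tr χ̲ + ⁽ᵃ⁾tr χ tr χ̲ + 4*ρ + 2η ∧ η̲ − ℑ(V̂)`" (p.854 L32–33) and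
"`ℜ(Ṽ) = ½tr χ tr χ̲ + ½⁽ᵃ⁾tr χ⁽ᵃ⁾tr χ̲ − 4ρ − 4η · η̲ − ℜ(V̂)`" (p.855 L25–36).
[cite: GiorgiKlainermanSzeftel2024, (D.4.15) p.848 L49–58, p.854 L32–35, p.855 L25–41; GiorgiKlainermanSzeftel2022, l.34674–34678, l.34897–34903, l.34938–34944] -/
theorem Vtilde_parts (i x y xb yb rh srh ee w VR VI : K) :
    (1 / 2 * x * xb + 1 / 2 * y * yb - 4 * rh - 4 * ee) + i * (-(x * yb) + y * xb + 4 * srh + 2 * w)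
        - (VR + i * VI)
      = (1 / 2 * x * xb + 1 / 2 * y * yb - 4 * rh - 4 * ee - VR)
        + i * (-(x * yb) + y * xb + 4 * srh + 2 * w - VI) := by
  ring

omit [CharZero K] in
/-- (D.4.9) `I₃₃ = −2ρ − 2η · (η − 2η̲) + i(8*ρ − 8η ∧ η̲) + ∇₄^(c)(C₁)`, `C₁ = 2tr χ̲ + C_R + iC_I`, `∇₄^(c) = D4 − 2ω`:
"`ℑ(I₃₃) = 8*ρ − 8η ∧ η̲ + ∇₄^(c)ℑ(C̃₁)`" (p.854 L36–37) and "`ℜ(I₃₃) = −2ρ − 2|η|² + 4η · η̲ + ∇₄^(c)ℜ(C₁)`" (p.855 L42–43).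
[cite: GiorgiKlainermanSzeftel2024, (D.4.9) p.830 L70–74, p.854 L36–37, p.855 L42–43, Lemma 2.2.17 p.105 L7–11; GiorgiKlainermanSzeftel2022, l.34094–34096, l.34906, l.34947, l.4559–4568] -/
theorem I33_parts (D4 : Derivation ℤ K K) (i om xb rh srh ne ee w CR CI : K) (hDi : D4 i = 0) :
    (-2 * rh - 2 * (ne - 2 * ee)) + i * (8 * srh - 8 * w)
        + (D4 (2 * xb + (CR + i * CI)) - 2 * om * (2 * xb + (CR + i * CI)))
      = (-2 * rh - 2 * ne + 4 * ee + (D4 (2 * xb + CR) - 2 * om * (2 * xb + CR)))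
        + i * (8 * srh - 8 * w + (D4 CI - 2 * om * CI)) := by
  obtain ⟨D2, -⟩ := D_num D4
  simp only [map_add, D4.leibniz, hDi, D2, smul_eq_mul, mul_zero, add_zero]
  ring

/-- (D.4.10) `J₃₃ = −2tr χ̲(½tr X + 2tr X‾) + 𝒟 · H̄ + 2H · H̄` with `tr X = tr χ − i⁽ᵃ⁾tr χ` (Definition 2.4.8),
`𝒟 · H̄ = 2div η − 2i curl η = 2div η − 2i div *η` (Lemma 2.4.4, conjugated), `2H · H̄ = 4|η|²` (§0):
"`ℑ(J₃₃) = −3tr χ̲⁽ᵃ⁾tr χ − 2div *η`" (p.854 L38) and "`ℜ(J₃₃) = −5tr χ̲ tr χ + 2div η + 4|η|²`" (p.855 L44).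
[cite: GiorgiKlainermanSzeftel2024, (D.4.10) p.837 L72–80, Definition 2.4.8 p.113 L29–60, Lemma 2.4.4 p.111 L17–31, p.854 L38, p.855 L44; GiorgiKlainermanSzeftel2022, l.34307–34309, l.4905–4921, l.34907, l.34948] -/
theorem J33_parts (i x y xb de dse e1 e2 : K) (hi : i ^ 2 = -1) :
    -2 * xb * (1 / 2 * (x - i * y) + 2 * (x + i * y)) + (2 * de - i * (2 * dse))
        + 2 * ((e1 + i * e2) * (e1 - i * e2) + (e2 - i * e1) * (e2 + i * e1))
      = (-5 * xb * x + 2 * de + 4 * (e1 ^ 2 + e2 ^ 2)) + i * (-3 * xb * y - 2 * dse) := by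
  linear_combination (-2 * (e1 ^ 2 + e2 ^ 2)) * hi

/-- (D.4.12) `K₃₃ = 2∇₃^(c)(−½tr X − 2tr X‾)` with `tr X = tr χ − i⁽ᵃ⁾tr χ`: `K₃₃ = −5∇₃^(c)tr χ − 3i∇₃^(c)⁽ᵃ⁾tr χ`, i.e.
"`ℑ(K₃₃) = −3∇₃^(c)⁽ᵃ⁾tr χ`" (p.854 L39) and "`ℜ(K₃₃) = −5∇₃^(c)tr χ`" (p.855 L46) (`D3 = ∇₃^(c)` on scalars, `D3 i = 0`).
[cite: GiorgiKlainermanSzeftel2024, (D.4.12) p.838 L34–37, p.854 L39, p.855 L46; GiorgiKlainermanSzeftel2022, l.34341, l.34908, l.34949] -/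
theorem K33_parts (D3 : Derivation ℤ K K) (i x y : K) (hDi : D3 i = 0) :
    2 * D3 (-(1 / 2) * (x - i * y) - 2 * (x + i * y)) = -5 * D3 x + i * (-3 * D3 y) := by
  obtain ⟨D2, -⟩ := D_num D3
  simp only [D3.leibniz, D3.leibniz_div, map_neg, map_sub, map_add, hDi, D2, smul_eq_mul, mul_zero, add_zero,
    sub_zero, Derivation.map_one_eq_zero, neg_zero]
  ring

/-- "`ℑ(K₃₃) = −3∇₃^(c)⁽ᵃ⁾tr χ = (3/2)(⁽ᵃ⁾tr χ̲ tr χ + tr χ̲⁽ᵃ⁾tr χ) + 6*ρ − 6div *η`" (p.854 L39–41) with Proposition 2.2.19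
(`∇₃^(c)⁽ᵃ⁾tr χ = −½(⁽ᵃ⁾tr χ̲ tr χ + tr χ̲⁽ᵃ⁾tr χ) + 2curl^(c)η − 2*ρ + [−χ̲̂ ∧ χ̂ + 2ξ̲ ∧ ξ]`, `curl η = div *η`) entered as
`h3y`, bracket in `Q`.
[cite: GiorgiKlainermanSzeftel2024, p.854 L39–41, Proposition 2.2.19 p.105 L45–47; GiorgiKlainermanSzeftel2022, l.34908–34909, l.4590–4591] -/
theorem K33_Im (x y xb yb srh dse d3y Q : K) (h3y : d3y = -(1 / 2) * (yb * x + xb * y) + 2 * dse - 2 * srh + Q) :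
    -3 * d3y = 3 / 2 * (yb * x + xb * y) + 6 * srh - 6 * dse - 3 * Q := by
  subst h3y
  ring

/-- "`ℜ(K₃₃) = −5∇₃^(c)tr χ = (5/2)tr χ̲ tr χ − (5/2)⁽ᵃ⁾tr χ̲⁽ᵃ⁾tr χ − 10div η − 10|η|² − 10ρ`" (p.855 L46–48) with
Proposition 2.2.19 (`∇₃^(c)tr χ = −½tr χ̲ tr χ + ½⁽ᵃ⁾tr χ̲⁽ᵃ⁾tr χ + 2div^(c)η + 2|η|² + 2ρ + [−χ̲̂ · χ̂ + 2ξ · ξ̲]`)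
entered as `h3x`, bracket in `Q`.
[cite: GiorgiKlainermanSzeftel2024, p.855 L46–48, Proposition 2.2.19 p.105 L38–40; GiorgiKlainermanSzeftel2022, l.34949–34950, l.4588–4589] -/
theorem K33_Re (x y xb yb rh de ne d3x Q : K)
    (h3x : d3x = -(1 / 2) * xb * x + 1 / 2 * yb * y + 2 * de + 2 * ne + 2 * rh + Q) :
    -5 * d3x = 5 / 2 * xb * x - 5 / 2 * yb * y - 10 * de - 10 * ne - 10 * rh - 5 * Q := by
  subst h3x
  ring

omit [CharZero K] in
/-- (D.4.13) `M₃₃ = 2η · (4H + H̲ + H̲‾) = 2(4(η + i*η) + 2η̲) · η` in components: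
"`ℑ(M₃₃) = 0`" (p.854 L42–44) and "`ℜ(M₃₃) = 8|η|² + 4η · η̲`" (p.855 L50–51).
[cite: GiorgiKlainermanSzeftel2024, (D.4.13) p.842 L9–12, p.854 L42–44, p.855 L50–51; GiorgiKlainermanSzeftel2022, l.34442–34443, l.34910, l.34951] -/
theorem M33_parts (i e1 e2 b1 b2 : K) :
    2 * (e1 * ((4 * e1 + 2 * b1) + i * (4 * e2)) + e2 * ((4 * e2 + 2 * b2) + i * (4 * (-e1))))
      = (8 * (e1 ^ 2 + e2 ^ 2) + 4 * (e1 * b1 + e2 * b2)) + i * 0 := by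
  ring

end Pieces

/-! ## §3. `ℑ(V₁) = 0` ⟸ (D.4.19) (`[J]` p.854 L45 – p.855 L24 = `[v1]` l.34912–34935) -/

section ImSide

variable {K : Type*} [Field K] [CharZero K]

/-- "which gives `ℑ(V̂) = (3/2)(⁽ᵃ⁾tr χ̲ tr χ − tr χ̲⁽ᵃ⁾tr χ) + 14*ρ − 8div *η − 8η ∧ η̲ + ∇₄^(c)ℑ(C̃₁)`" — the sum of the four
imaginary parts of §2 (`d4I = ∇₄^(c)ℑ(C̃₁)`).
[cite: GiorgiKlainermanSzeftel2024, p.854 L36–50; GiorgiKlainermanSzeftel2022, l.34905–34914] -/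
theorem Vhat_Im (x y xb yb srh dse w d4I : K) :
    (8 * srh - 8 * w + d4I) + (-3 * xb * y - 2 * dse) + (3 / 2 * (yb * x + xb * y) + 6 * srh - 6 * dse) + 0
      = 3 / 2 * (yb * x - xb * y) + 14 * srh - 8 * dse - 8 * w + d4I := by
  ring

/-- "and `ℑ(Ṽ) = −(5/2)(tr χ⁽ᵃ⁾tr χ̲ − tr χ̲⁽ᵃ⁾tr χ) − 10*ρ + 8div *η + 10η ∧ η̲ − ∇₄^(c)ℑ(C̃₁)`".
[cite: GiorgiKlainermanSzeftel2024, p.854 L32–33, L51–56; GiorgiKlainermanSzeftel2022, l.34899, l.34915–34918] -/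
theorem Vtilde_Im (x y xb yb srh dse w d4I : K) :
    (-(x * yb) + y * xb + 4 * srh + 2 * w) - (3 / 2 * (yb * x - xb * y) + 14 * srh - 8 * dse - 8 * w + d4I)
      = -(5 / 2) * (x * yb - xb * y) - 10 * srh + 8 * dse + 10 * w - d4I := by
  ring

/-- "Combining the above with Lemma D.4.6, we finally deduce
`ℑ(V₁) = ℑ(f⁻¹□_g(f) + Ṽ) = −½(tr χ⁽ᵃ⁾tr χ̲ + tr χ̲⁽ᵃ⁾tr χ) − 8*ρ + div(*η + *η̲) + 8div *η − ∇₄^(c)ℑ(C̃₁)`".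
[cite: GiorgiKlainermanSzeftel2024, p.855 L5–11, (D.4.18) p.849 L92–103; GiorgiKlainermanSzeftel2022, l.34919–34924, l.34736] -/
theorem V1_Im (x y xb yb srh dse dseb w d4I : K) :
    (-3 * xb * y + 2 * x * yb + 2 * srh + (dse + dseb) - 10 * w)
        + (-(5 / 2) * (x * yb - xb * y) - 10 * srh + 8 * dse + 10 * w - d4I)
      = -(1 / 2) * (x * yb + xb * y) - 8 * srh + (dse + dseb) + 8 * dse - d4I := by
  ring

/-- "Using that, see (3.4.2), `tr χ⁽ᵃ⁾tr χ̲ + tr χ̲⁽ᵃ⁾tr χ = r⁻¹Γ_g`, `div(*η + *η̲) = r⁻¹𝔡Γ_g`, we deduce that in order to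
obtain `ℑ(V₁) = 0` we need to have (D.4.19) `∇₄^(c)ℑ(C̃₁) = −8*ρ − 8div *η̲ + r⁻¹𝔡^{≤1}Γ_b`": with the two (3.4.2)
quantities named `g1`, `g2`, `ℑ(V₁) = (−8*ρ − 8div *η̲ − ∇₄^(c)ℑ(C̃₁)) − ½g1 + 9g2`.
[cite: GiorgiKlainermanSzeftel2024, p.855 L12–24, (D.4.19) p.855 L15–21, (3.4.2) p.129 L140–150; GiorgiKlainermanSzeftel2022, l.34925–34935, l.5871–5877] -/
theorem condition_D419 (x y xb yb srh dse dseb d4I g1 g2 : K) (h342a : x * yb + xb * y = g1)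
    (h342d : dse + dseb = g2) :
    -(1 / 2) * (x * yb + xb * y) - 8 * srh + (dse + dseb) + 8 * dse - d4I
      = (-8 * srh - 8 * dseb - d4I) - 1 / 2 * g1 + 9 * g2 := by
  subst h342a h342d
  ring

end ImSide

/-! ## §4. `V₁` real: the real side up to the regrouping of `GRWTransformationAlgebra.V1_regroup`
(`[J]` p.855 L52 – p.856 L10 = `[v1]` l.34953–34971) -/

section ReSide

variable {K : Type*} [Field K] [CharZero K]

/-- "which gives `ℜ(V̂) = −(5/2)tr χ tr χ̲ − (5/2)⁽ᵃ⁾tr χ⁽ᵃ⁾tr χ̲ − 12ρ − 8div η + 8η · η̲ + ∇₄^(c)ℜ(C₁)`" — the sum of the four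
real parts of §2 (`d4R = ∇₄^(c)ℜ(C₁)`, `ne = |η|²`, `ee = η · η̲`).
[cite: GiorgiKlainermanSzeftel2024, p.855 L42–59; GiorgiKlainermanSzeftel2022, l.34946–34957] -/
theorem Vhat_Re (x y xb yb rh de ne ee d4R : K) :
    (-2 * rh - 2 * ne + 4 * ee + d4R) + (-5 * xb * x + 2 * de + 4 * ne)
        + (5 / 2 * xb * x - 5 / 2 * yb * y - 10 * de - 10 * ne - 10 * rh) + (8 * ne + 4 * ee)
      = -(5 / 2) * x * xb - 5 / 2 * y * yb - 12 * rh - 8 * de + 8 * ee + d4R := by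
  ring

/-- "and consequently `ℜ(Ṽ) = 3tr χ tr χ̲ + 3⁽ᵃ⁾tr χ⁽ᵃ⁾tr χ̲ + 8ρ + 8div η − 12η · η̲ − ∇₄(ℜ(C₁))`".
[cite: GiorgiKlainermanSzeftel2024, p.855 L25–36, L60–64; GiorgiKlainermanSzeftel2022, l.34940, l.34958–34962] -/
theorem Vtilde_Re (x y xb yb rh de ee d4R : K) :
    (1 / 2 * x * xb + 1 / 2 * y * yb - 4 * rh - 4 * ee)
        - (-(5 / 2) * x * xb - 5 / 2 * y * yb - 12 * rh - 8 * de + 8 * ee + d4R)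
      = 3 * x * xb + 3 * y * yb + 8 * rh + 8 * de - 12 * ee - d4R := by
  ring

omit [CharZero K] in
/-- "Since `V₁` is real, we deduce `V₁ = ℜ(f⁻¹□_g(f)) + ℜ(Ṽ) = −2tr χ tr χ̲ + ⁽ᵃ⁾tr χ⁽ᵃ⁾tr χ̲ + 4ρ + 2div(η − η̲) +
3(|η|² + |η̲|²) + 2η · η̲ + 8div η − ∇₄(ℜ(C₁))`" (`nb = |η̲|²`).
[cite: GiorgiKlainermanSzeftel2024, p.856 L5–8; GiorgiKlainermanSzeftel2022, l.34963–34967] -/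
theorem V1_Re (x y xb yb rh de deb ne nb ee d4R : K) :
    (-5 * x * xb - 2 * y * yb - 4 * rh + 2 * (de - deb) + 3 * (ne + nb) + 14 * ee)
        + (3 * x * xb + 3 * y * yb + 8 * rh + 8 * de - 12 * ee - d4R)
      = -2 * x * xb + y * yb + 4 * rh + 2 * (de - deb) + 3 * (ne + nb) + 2 * ee + 8 * de - d4R := by
  ring

omit [CharZero K] in
/-- "which we write, using (3.4.2) (`div(η − η̲) = r⁻¹𝔡Γ_g`, `|η|² − |η̲|² = r⁻¹Γ_g`), as
`V₁ = −2tr χ tr χ̲ + ⁽ᵃ⁾tr χ⁽ᵃ⁾tr χ̲ + 4ρ + 8div η̲ + 6|η̲|² + 2η · η̲ − ∇₄(ℜ(C₁))`" — with the two (3.4.2) quantities named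
`g3`, `g4` the remainder is `10g3 + 3g4`.  The first six terms are the head of the left side of
`GRWTransformationAlgebra.V1_regroup`, where the computation continues (p.856 L11 onward).
[cite: GiorgiKlainermanSzeftel2024, p.856 L9–10, (3.4.2) p.129 L140–150; GiorgiKlainermanSzeftel2022, l.34968–34971, l.5871–5877] -/
theorem V1_Re_342 (x y xb yb rh de deb ne nb ee d4R g3 g4 : K) (h342c : de - deb = g3) (h342b : ne - nb = g4) :
    -2 * x * xb + y * yb + 4 * rh + 2 * (de - deb) + 3 * (ne + nb) + 2 * ee + 8 * de - d4R
      = (-2 * x * xb + y * yb + 4 * rh + 8 * deb + 6 * nb + 2 * ee - d4R) + (10 * g3 + 3 * g4) := by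
  have hde : de = g3 + deb := by rw [← h342c]; ring
  have hne : ne = g4 + nb := by rw [← h342b]; ring
  subst hde hne
  ring

end ReSide

/-! ## §5. `ℑ(Z₄₃)` (`[J]` p.857 L73 – p.858 L16 = `[v1]` l.35019–35026)

The explicit `Z₄₃` chain for `ℜ(C̃₁) = −2⁽ᵃ⁾tr χ̲²/tr χ̲` (p.858 L17–64) is `GRWTransformationAlgebra.Z43_leibniz/Z43_algebra/Z43_kerr`. -/

section Z43Im

variable {K : Type*} [Field K]

/-- "Recall `Z₄₃ = ∇₃^(c)C̃₁ + tr χ̲ C̃₁`. In particular `ℑ(Z₄₃) = ∇₃^(c)ℑ(C̃₁) + tr χ̲ ℑ(C̃₁)`": with `C̃₁ = C_R + iC_I`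
(`(−1)`-conformal like `C₁`, so `∇₃^(c) = D3 + 2ω̲`, Lemma 2.2.17) and `D3 i = 0`, real and imaginary parts separate.
[cite: GiorgiKlainermanSzeftel2024, p.857 L73–78, p.858 L5–14, Lemma 2.2.17 p.105 L7–11; GiorgiKlainermanSzeftel2022, l.35019–35025, l.4559–4568] -/
theorem Z43_parts (D3 : Derivation ℤ K K) (i omb xb CR CI : K) (hDi : D3 i = 0) :
    (D3 (CR + i * CI) + 2 * omb * (CR + i * CI)) + xb * (CR + i * CI)
      = ((D3 CR + 2 * omb * CR) + xb * CR) + i * ((D3 CI + 2 * omb * CI) + xb * CI) := by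
  simp only [map_add, D3.leibniz, hDi, smul_eq_mul, mul_zero, add_zero]
  ring

/-- "`ℑ(Z₄₃) = ∇₃^(c)ℑ(C̃₁) + tr χ̲ ℑ(C̃₁) = r⁻¹Γ_b` if `ℑ(C̃₁) = n⁽ᵃ⁾tr χ̲` for any `n`": for a constant `nn` (`D3 nn = 0`),
`∇₃^(c)(nn⁽ᵃ⁾tr χ̲) + tr χ̲(nn⁽ᵃ⁾tr χ̲) = nn(∇₃^(c)⁽ᵃ⁾tr χ̲ + tr χ̲⁽ᵃ⁾tr χ̲)`; the bracket is what Proposition 2.2.19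
(`∇₃^(c)⁽ᵃ⁾tr χ̲ = −tr χ̲⁽ᵃ⁾tr χ̲ + 2curl^(c)ξ̲ + 2ξ̲ ∧ (−η + η̲)`) makes `Γ_b`, and it vanishes exactly on the outgoing Kerr
tables (`kerr_Z43_Im`, §8).
[cite: GiorgiKlainermanSzeftel2024, p.858 L5–16, Proposition 2.2.19 p.105 L23; GiorgiKlainermanSzeftel2022, l.35023–35026, l.4584] -/
theorem Z43_Im_n (D3 : Derivation ℤ K K) (nn omb xb yb : K) (hn : D3 nn = 0) :
    (D3 (nn * yb) + 2 * omb * (nn * yb)) + xb * (nn * yb) = nn * ((D3 yb + 2 * omb * yb) + xb * yb) := by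
  rw [D3.leibniz, hn, smul_eq_mul, smul_eq_mul, mul_zero, add_zero]
  ring

end Z43Im

/-! ## §6. `ℑ(Z_{a3})` and the condition (D.4.20) (`[J]` p.858 L68 – p.859 L53 = `[v1]` l.35037–35086)

Horizontal 1-forms are elements of a `K`-module `V`; the Hodge dual is a linear map `st` with `st ∘ st = −id`
(Lemma 2.1.10); `∇₃^(c)` acts on `V` as a `GRWTransformationAlgebra.CovD` (additive, Leibniz over a derivation `D3`;
no other property is assumed, commutation with `st` is an explicit hypothesis where the text uses it); the horizontal
(conformal) gradients of the scalars `ℑ(C̃₁)`, `⁽ᵃ⁾tr χ̲`, … are opaque vectors except in §7, where the Leibniz rule is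
needed and `∇` is a `V`-valued derivation.  `e = η`, `eb = η̲`, `se = *η`, `seb = *η̲`. -/

section Za3Im

variable {K : Type*} [Field K] {V : Type*} [AddCommGroup V] [Module K V]

/-- `U := 4H + H̲ + H̲‾ = 4(η + i*η) + (η̲ + i*η̲) + (η̲ − i*η̲)` has real part `4η + 2η̲` and imaginary part `4*η`.  The
`ℑ(M_{a3})` display (p.858 L81–83) writes `U` as `4η + 4i*η` — the real `2η̲` does not enter imaginary parts; the
`ℜ(M_{a3})` display (p.859 L57–60) uses `4η + 2η̲`.
[cite: GiorgiKlainermanSzeftel2024, (D.4.13) p.842 L9–12, p.858 L81–83, p.859 L57–60; GiorgiKlainermanSzeftel2022, l.34442, l.35052–35054, l.35092] -/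
theorem U_parts (e eb se seb : V) :
    ((4 : K) • e + eb + eb = (4 : K) • e + (2 : K) • eb) ∧ ((4 : K) • se + seb + -seb = (4 : K) • se) := by
  constructor <;> module

/-- "`ℑ(M_{a3}) = ℑ(2∇₃^(c)(4η + 4i*η) − tr χ̲(4η + 4i*η) + ⁽ᵃ⁾tr χ̲*(4η + 4i*η)) = 8∇₃^(c)*η − 4tr χ̲*η − 4⁽ᵃ⁾tr χ̲ η`":
the imaginary part is `2∇₃^(c)(4*η) − tr χ̲(4*η) + ⁽ᵃ⁾tr χ̲*(4*η)`, with `** = −1` and `∇₃^(c)(4u) = 4∇₃^(c)u`.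
[cite: GiorgiKlainermanSzeftel2024, p.858 L79–83, Lemma 2.1.10 p.68 L32–36; GiorgiKlainermanSzeftel2022, l.35048, l.35052–35054, l.2710–2715] -/
theorem Ma3_Im (D3 : Derivation ℤ K K) (nab : CovD D3 V) (st : V →ₗ[K] V) (hst : ∀ u, st (st u) = -u)
    (xb yb : K) (e : V) :
    (2 : K) • nab.op ((4 : K) • st e) - xb • ((4 : K) • st e) + yb • st ((4 : K) • st e)
      = (8 : K) • nab.op (st e) - (4 * xb) • st e - (4 * yb) • e := by
  obtain ⟨-, -, D4, -⟩ := D_num D3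
  rw [nab.leibniz, D4, zero_smul, zero_add, map_smul, hst]
  module

/-- `ℑ(L_{a3}) = 2⁽ᵃ⁾tr χ̲(η − η̲)`, `ℑ(I_{a3}) = −2ℑ(C̃₁)(η − η̲)`,
`ℑ(J_{a3}) = −2∇^(c)ℑ(C̃₁) + 2ℑ(C̃₁)η + 4tr χ̲*η + 2⁽ᵃ⁾tr χ̲ η + 2⁽ᵃ⁾tr χ̲ η̲` are read off
`L_{a3} = −2(tr χ̲ − i⁽ᵃ⁾tr χ̲)(η − η̲)`, `I_{a3} = −2∇₃^(c)(η − η̲) − (2C₁ − tr χ̲)(η − η̲) − ⁽ᵃ⁾tr χ̲*(η − η̲)`,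
`J_{a3} = 2∇₃^(c)η − 2∇^(c)C₁ + 2C₁η + tr χ̲(8η̲ + 2η) − 2⁽ᵃ⁾tr χ̲*η̲ + i(4tr χ̲*η + 2⁽ᵃ⁾tr χ̲ η + 2⁽ᵃ⁾tr χ̲ η̲)` (real operators,
`ℑ(C₁) = ℑ(C̃₁) =: C_I`, `gI = ∇^(c)C_I`, `n3se = ∇₃^(c)*η`) and `ℑ(M_{a3})` is `Ma3_Im`: "We therefore obtain
`ℑ(Z_{a3}) = −2∇^(c)ℑ(C̃₁) − 2ℑ(C̃₁)η̲ + 8∇₃^(c)*η`" (`Z_{a3} = I_{a3} + J_{a3} + L_{a3} + M_{a3} − 4C₁η̲`).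
[cite: GiorgiKlainermanSzeftel2024, p.844 L18, p.858 L68–90, p.859 L5–8; GiorgiKlainermanSzeftel2022, l.34532, l.35037–35065] -/
theorem Za3_Im_sum (CI xb yb : K) (e eb se gI n3se : V) :
    (-(2 * CI)) • (e - eb)
        + (-((2 : K) • gI) + (2 * CI) • e + (4 * xb) • se + (2 * yb) • e + (2 * yb) • eb)
        + (2 * yb) • (e - eb)
        + ((8 : K) • n3se - (4 * xb) • se - (4 * yb) • e)
        - (4 * CI) • eb
      = -((2 : K) • gI) - (2 * CI) • eb + (8 : K) • n3se := by
  module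

/-- "Using that, see (3.4.8), `∇₃*η + tr χ̲*η − ⁽ᵃ⁾tr χ̲ η = 𝔡^{≤1}Γ_g`": the Hodge dual of the (3.4.8) relation
`∇₃η + tr χ̲ η + ⁽ᵃ⁾tr χ̲*η = 0` (exact in Kerr; entered with right side `g`, the `𝔡^{≤1}Γ_g` of p.859), with `[∇₃, *] = 0`
entered as `hc` and `** = −1`.
[cite: GiorgiKlainermanSzeftel2024, (3.4.8) p.133 L85–92, p.859 L9–10; GiorgiKlainermanSzeftel2022, l.6060–6065, l.35066–35069] -/
theorem dual_348_1b (D3 : Derivation ℤ K K) (nab : CovD D3 V) (st : V →ₗ[K] V) (hst : ∀ u, st (st u) = -u)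
    (xb yb : K) (e g : V) (hc : nab.op (st e) = st (nab.op e)) (h : nab.op e + xb • e + yb • st e = g) :
    nab.op (st e) + xb • st e - yb • e = st g := by
  subst h
  rw [hc, map_add, map_add, map_smul, map_smul, hst]
  module

/-- "we deduce that in order to have `ℑ(Z_{a3}) = 0`, we need to have (D.4.20)
`∇^(c)ℑ(C̃₁) + ℑ(C̃₁)η̲ = −4(tr χ̲*η − ⁽ᵃ⁾tr χ̲ η) + 𝔡^{≤1}Γ_g`": substituting `∇₃^(c)*η = −tr χ̲*η + ⁽ᵃ⁾tr χ̲ η + *Γ`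
(`sg = *Γ`) into `Za3_Im_sum`, `ℑ(Z_{a3}) = −2(∇^(c)C_I + C_I η̲ + 4(tr χ̲*η − ⁽ᵃ⁾tr χ̲ η) − 4*Γ)`.
[cite: GiorgiKlainermanSzeftel2024, (D.4.20) p.859 L11–18; GiorgiKlainermanSzeftel2022, l.35070–35073] -/
theorem condition_D420 (CI xb yb : K) (e eb se gI n3se sg : V) (h348 : n3se + xb • se - yb • e = sg) :
    -((2 : K) • gI) - (2 * CI) • eb + (8 : K) • n3se
      = -((2 : K) • (gI + CI • eb + (4 : K) • (xb • se - yb • e) - (4 : K) • sg)) := by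
  rw [show n3se = sg - xb • se + yb • e by rw [← h348]; module]
  module

/-- (D.4.20) as an equivalence: `ℑ(Z_{a3}) = 0 ↔ ∇^(c)ℑ(C̃₁) + ℑ(C̃₁)η̲ = −4(tr χ̲*η − ⁽ᵃ⁾tr χ̲ η) + 4*Γ`
(characteristic zero).
[cite: GiorgiKlainermanSzeftel2024, (D.4.20) p.859 L11–18; GiorgiKlainermanSzeftel2022, l.35070–35073] -/
theorem condition_D420_iff [CharZero K] (CI xb yb : K) (e eb se gI n3se sg : V)
    (h348 : n3se + xb • se - yb • e = sg) :
    -((2 : K) • gI) - (2 * CI) • eb + (8 : K) • n3se = 0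
      ↔ gI + CI • eb = -((4 : K) • (xb • se - yb • e)) + (4 : K) • sg := by
  rw [condition_D420 CI xb yb e eb se gI n3se sg h348, neg_eq_zero, smul_eq_zero,
    or_iff_right (by norm_num : (2 : K) ≠ 0), sub_eq_zero, ← eq_sub_iff_add_eq, sub_eq_neg_add]

/-- The Hodge dual of the (3.4.8) relation `tr χ̲(η + η̲) + ⁽ᵃ⁾tr χ̲(*η̲ − *η) = 0` (exact in Kerr; right side named
`g0`): "`tr χ̲(*η + *η̲) − ⁽ᵃ⁾tr χ̲(η̲ − η) = r⁻¹Γ_g`" (`= *g0`), used at the last step of the next chain.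
[cite: GiorgiKlainermanSzeftel2024, (3.4.8) p.133 L85–92, p.859 L52–53; GiorgiKlainermanSzeftel2022, l.6060–6065, l.35085–35086] -/
theorem dual_348_2b (st : V →ₗ[K] V) (hst : ∀ u, st (st u) = -u) (xb yb : K) (e eb g0 : V)
    (h : xb • (e + eb) + yb • (st eb - st e) = g0) :
    xb • (st e + st eb) - yb • (eb - e) = st g0 := by
  subst h
  simp only [map_add, map_sub, map_smul, hst]
  module

/-- "Observe that, using (3.4.10), i.e. `∇⁽ᵃ⁾tr χ̲ = −(3/2)⁽ᵃ⁾tr χ̲(η̲ + η) + ½tr χ̲(*η − *η̲) + r⁻¹Γ_g`, we obtain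
`∇^(c)⁽ᵃ⁾tr χ̲ + ⁽ᵃ⁾tr χ̲ η̲ = ∇⁽ᵃ⁾tr χ̲ + ⁽ᵃ⁾tr χ̲(η̲ − ζ) = −(3/2)⁽ᵃ⁾tr χ̲(η̲ + η) + ½tr χ̲(*η − *η̲) + ⁽ᵃ⁾tr χ̲(η̲ − ζ) + r⁻¹Γ_g
= ½⁽ᵃ⁾tr χ̲ η̲ − (3/2)⁽ᵃ⁾tr χ̲ η + ½tr χ̲(*η − *η̲) + r⁻¹Γ_g = tr χ̲*η − ⁽ᵃ⁾tr χ̲ η + r⁻¹Γ_g`, where we used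
`tr χ̲(*η + *η̲) − ⁽ᵃ⁾tr χ̲(η̲ − η) = r⁻¹Γ_g`" — four displayed lines: `∇^(c) = ∇ − ζ` on the `(−1)`-conformal `⁽ᵃ⁾tr χ̲`
(Lemma 2.2.17 (3)), `ζ = −η̲` in Kerr (outgoing table, `[J]` p.127 L151), (3.4.10) second line with remainder `g1`, and
the dual (3.4.8) relation with value `g2` entering with the factor `−½` (`gyb = ∇⁽ᵃ⁾tr χ̲`, `ze = ζ`).
[cite: GiorgiKlainermanSzeftel2024, p.859 L20–53, (3.4.10) p.134 L5–18, Lemma 2.2.17 p.105 L7–11, p.127 L130–156; GiorgiKlainermanSzeftel2022, l.35074–35086, l.6078–6082, l.4566, l.5739] -/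
theorem D420_satisfied [CharZero K] (xb yb : K) (e eb ze gyb g1 g2 : V) (st : V →ₗ[K] V)
    (h3410 : gyb = -(3 / 2 * yb) • (eb + e) + (1 / 2 * xb) • (st e - st eb) + g1) (hze : ze = -eb)
    (h348 : xb • (st e + st eb) - yb • (eb - e) = g2) :
    ((gyb - yb • ze) + yb • eb = gyb + yb • (eb - ze)) ∧
    (gyb + yb • (eb - ze) = -(3 / 2 * yb) • (eb + e) + (1 / 2 * xb) • (st e - st eb) + yb • (eb - ze) + g1) ∧
    (-(3 / 2 * yb) • (eb + e) + (1 / 2 * xb) • (st e - st eb) + yb • (eb - ze) + g1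
      = (1 / 2 * yb) • eb - (3 / 2 * yb) • e + (1 / 2 * xb) • (st e - st eb) + g1) ∧
    ((1 / 2 * yb) • eb - (3 / 2 * yb) • e + (1 / 2 * xb) • (st e - st eb) + g1
      = xb • st e - yb • e + (g1 - (1 / 2 : K) • g2)) := by
  subst h3410 hze h348
  refine ⟨by module, by module, by module, by module⟩

/-- "Therefore, if `ℑ(C̃₁) = −4⁽ᵃ⁾tr χ̲`, relation (D.4.20) is satisfied": with `gI = ∇^(c)(−4⁽ᵃ⁾tr χ̲) = −4∇^(c)⁽ᵃ⁾tr χ̲`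
(`gcyb = ∇^(c)⁽ᵃ⁾tr χ̲`), the left side of (D.4.20) is `−4(∇^(c)⁽ᵃ⁾tr χ̲ + ⁽ᵃ⁾tr χ̲ η̲)`, which the previous chain
evaluates to `−4(tr χ̲*η − ⁽ᵃ⁾tr χ̲ η) + Γ`.
[cite: GiorgiKlainermanSzeftel2024, p.859 L52–53; GiorgiKlainermanSzeftel2022, l.35086] -/
theorem D420_choice (xb yb : K) (e eb se gcyb rem : V) (h : gcyb + yb • eb = xb • se - yb • e + rem) :
    (-(4 : K)) • gcyb + (-4 * yb) • eb = -((4 : K) • (xb • se - yb • e)) + (-(4 : K)) • rem := by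
  rw [show gcyb = xb • se - yb • e + rem - yb • eb by rw [← h]; module]
  module

end Za3Im

/-! ## §7. `ℜ(Z_{a3})`, `ℜ(Z₁₃) = 0`, `ℜ(Z₂₃)` (`[J]` p.859 L55 – p.861 L150 = `[v1]` l.35089–35158) -/

section Za3Re

variable {K : Type*} [Field K] [CharZero K] {V : Type*} [AddCommGroup V] [Module K V]

omit [CharZero K] in
/-- "`ℜ(M_{a3}) = 4∇₃^(c)(2η + η̲) − tr χ̲(4η + 2η̲) + ⁽ᵃ⁾tr χ̲*(4η + 2η̲)`": from the real part `4η + 2η̲` of `U` (`U_parts`),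
`2∇₃^(c)(4η + 2η̲) = 4∇₃^(c)(2η + η̲)`.
[cite: GiorgiKlainermanSzeftel2024, p.859 L57–60; GiorgiKlainermanSzeftel2022, l.35092] -/
theorem Ma3_Re (D3 : Derivation ℤ K K) (nab : CovD D3 V) (e eb : V) :
    (2 : K) • nab.op ((4 : K) • e + (2 : K) • eb) = (4 : K) • nab.op ((2 : K) • e + eb) := by
  obtain ⟨D2, -, D4, -⟩ := D_num D3
  simp only [map_add, nab.leibniz, D2, D4, zero_smul, zero_add]
  module

omit [CharZero K] in
/-- "recalling that `ℜ(C₁) = 2tr χ̲ + ℜ(C̃₁)`,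
`ℜ(I_{a3}) = −2∇₃^(c)(η − η̲) − (2ℜ(C₁) − tr χ̲)(η − η̲) − ⁽ᵃ⁾tr χ̲*(η − η̲) = −2∇₃^(c)(η − η̲) − (2ℜ(C̃₁) + 3tr χ̲)(η − η̲) − ⁽ᵃ⁾tr χ̲*(η − η̲)`"
(`CR = ℜ(C̃₁)`).
[cite: GiorgiKlainermanSzeftel2024, p.859 L62–66; GiorgiKlainermanSzeftel2022, l.35095–35097] -/
theorem Ia3_Re (D3 : Derivation ℤ K K) (nab : CovD D3 V) (st : V →ₗ[K] V) (xb yb CR : K) (e eb : V) :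
    -((2 : K) • nab.op (e - eb)) - (2 * (2 * xb + CR) - xb) • (e - eb) - yb • st (e - eb)
      = -((2 : K) • nab.op (e - eb)) - (2 * CR + 3 * xb) • (e - eb) - yb • st (e - eb) := by
  module

omit [CharZero K] in
/-- "`ℜ(J_{a3}) = 2∇₃^(c)η − 2∇^(c)ℜ(C₁) + 2ℜ(C₁)η + tr χ̲(8η̲ + 2η) − 2⁽ᵃ⁾tr χ̲*η̲ = 2∇₃^(c)η − 4∇^(c)tr χ̲ − 2∇^(c)ℜ(C̃₁) +
2(2tr χ̲ + ℜ(C̃₁))η + tr χ̲(8η̲ + 2η) − 2⁽ᵃ⁾tr χ̲*η̲ = 2∇₃^(c)η − 4∇^(c)tr χ̲ − 2∇^(c)ℜ(C̃₁) + 2ℜ(C̃₁)η + tr χ̲(8η̲ + 6η) − 2⁽ᵃ⁾tr χ̲*η̲`":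
`∇^(c)` on the `(−1)`-conformal scalars `tr χ̲`, `ℜ(C̃₁)`, `ℜ(C₁)` (`= ∇ + η̲·` in Kerr) is one additive map `Gc : K →+ V`.
[cite: GiorgiKlainermanSzeftel2024, p.859 L67–73; GiorgiKlainermanSzeftel2022, l.35098–35101] -/
theorem Ja3_Re (D3 : Derivation ℤ K K) (nab : CovD D3 V) (st : V →ₗ[K] V) (Gc : K →+ V) (xb yb CR : K) (e eb : V) :
    (2 : K) • nab.op e - (2 : K) • Gc (2 * xb + CR) + (2 * (2 * xb + CR)) • e + xb • ((8 : K) • eb + (2 : K) • e)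
        - (2 * yb) • st eb
      = (2 : K) • nab.op e - (4 : K) • Gc xb - (2 : K) • Gc CR + (2 * CR) • e + xb • ((8 : K) • eb + (6 : K) • e)
        - (2 * yb) • st eb := by
  rw [map_add, show Gc (2 * xb) = (2 : K) • Gc xb by rw [two_mul, map_add, two_smul]]
  module

omit [CharZero K] in
/-- "We therefore obtain `ℜ(Z_{a3}) = ℜ(I_{a3}) + ℜ(J_{a3}) + ℜ(L_{a3}) + ℜ(M_{a3}) − 4(2tr χ̲ + ℜ(C̃₁))η̲
= 6∇₃^(c)η̲ + 8∇₃^(c)η − 4∇^(c)tr χ̲ − 2∇^(c)ℜ(C̃₁) − 2ℜ(C̃₁)η̲ + tr χ̲(3η̲ − 3η) + ⁽ᵃ⁾tr χ̲*(3η + η̲)`"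
(`ℜ(L_{a3}) = −2tr χ̲(η − η̲)`; `Gxb = ∇^(c)tr χ̲`, `GCR = ∇^(c)ℜ(C̃₁)`).
[cite: GiorgiKlainermanSzeftel2024, p.859 L55–56, p.860 L5–21; GiorgiKlainermanSzeftel2022, l.35091, l.35103–35112] -/
theorem Za3_Re_sum (D3 : Derivation ℤ K K) (nab : CovD D3 V) (st : V →ₗ[K] V) (xb yb CR : K)
    (e eb Gxb GCR : V) :
    (-((2 : K) • nab.op (e - eb)) - (2 * CR + 3 * xb) • (e - eb) - yb • st (e - eb))
        + ((2 : K) • nab.op e - (4 : K) • Gxb - (2 : K) • GCR + (2 * CR) • e + xb • ((8 : K) • eb + (6 : K) • e)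
            - (2 * yb) • st eb)
        + (-((2 * xb) • (e - eb)))
        + ((4 : K) • nab.op ((2 : K) • e + eb) - xb • ((4 : K) • e + (2 : K) • eb)
            + yb • st ((4 : K) • e + (2 : K) • eb))
        - (4 * (2 * xb + CR)) • eb
      = (6 : K) • nab.op eb + (8 : K) • nab.op e - (4 : K) • Gxb - (2 : K) • GCR - (2 * CR) • eb
        + xb • ((3 : K) • eb - (3 : K) • e) + yb • st ((3 : K) • e + eb) := by
  obtain ⟨D2, -⟩ := D_num D3
  simp only [map_sub, map_add, map_smul, nab.leibniz, D2, zero_smul, zero_add]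
  module

/-- "Using the null structure equation for `∇₃^(c)η̲`, (3.4.8) and (3.4.10), we obtain
`ℜ(Z_{a3}) = 6(−½tr χ̲(η̲ − η) + ½⁽ᵃ⁾tr χ̲(*η̲ − *η)) + 8(−tr χ̲ η − ⁽ᵃ⁾tr χ̲*η) − 4(−(3/2)tr χ̲(η̲ + η) − ½⁽ᵃ⁾tr χ̲(*η − *η̲) + tr χ̲ η̲)
− 2∇^(c)ℜ(C̃₁) − 2ℜ(C̃₁)η̲ + tr χ̲(3η̲ − 3η) + ⁽ᵃ⁾tr χ̲*(3η + η̲) + r⁻¹Γ_b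
= −2∇^(c)ℜ(C̃₁) − 2ℜ(C̃₁)η̲ + 2tr χ̲(η̲ − η) + 2⁽ᵃ⁾tr χ̲(*η̲ − 3*η) + r⁻¹Γ_b`": the three substituted values — Proposition
2.2.19 (`∇₃^(c)η̲ − ∇₄^(c)ξ̲ = −χ̲̂·(η̲ − η) − ½tr χ̲(η̲ − η) + ½⁽ᵃ⁾tr χ̲(*η̲ − *η) + β̲`, Kerr: `ξ̲ = χ̲̂ = β̲ = 0`), (3.4.8)
(`∇₃η = −tr χ̲ η − ⁽ᵃ⁾tr χ̲*η`), and (3.4.10) with `∇^(c)tr χ̲ = ∇tr χ̲ + tr χ̲ η̲` (`∇^(c) = ∇ − ζ`, `ζ = −η̲`) — enter as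
hypotheses with remainders `r1, r2, r3`.
[cite: GiorgiKlainermanSzeftel2024, p.860 L22–44, Proposition 2.2.19 p.106 L26–27, (3.4.8) p.133 L85–92, (3.4.10) p.134 L5–18; GiorgiKlainermanSzeftel2022, l.35113–35119, l.4611, l.6060–6065, l.6078–6082] -/
theorem Za3_Re_subst (D3 : Derivation ℤ K K) (nab : CovD D3 V) (st : V →ₗ[K] V) (xb yb CR : K)
    (e eb Gxb GCR r1 r2 r3 : V)
    (hN3eb : nab.op eb = -(1 / 2 * xb) • (eb - e) + (1 / 2 * yb) • (st eb - st e) + r1)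
    (hN3e : nab.op e = -(xb • e) - yb • st e + r2)
    (hGxb : Gxb = -(3 / 2 * xb) • (eb + e) - (1 / 2 * yb) • (st e - st eb) + xb • eb + r3) :
    (6 : K) • nab.op eb + (8 : K) • nab.op e - (4 : K) • Gxb - (2 : K) • GCR - (2 * CR) • eb
        + xb • ((3 : K) • eb - (3 : K) • e) + yb • st ((3 : K) • e + eb)
      = -((2 : K) • GCR) - (2 * CR) • eb + (2 * xb) • (eb - e) + (2 * yb) • (st eb - (3 : K) • st e)
        + ((6 : K) • r1 + (8 : K) • r2 - (4 : K) • r3) := by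
  rw [hN3eb, hN3e, hGxb, map_add, map_smul]
  module

omit [CharZero K] in
/-- "Observe that `∇^(c)(⁽ᵃ⁾tr χ̲²/tr χ̲) = ∇(⁽ᵃ⁾tr χ̲²/tr χ̲) − ζ⁽ᵃ⁾tr χ̲²/tr χ̲ = ∇(⁽ᵃ⁾tr χ̲²/tr χ̲) + η̲⁽ᵃ⁾tr χ̲²/tr χ̲
= −(⁽ᵃ⁾tr χ̲²/tr χ̲²)∇tr χ̲ + (2⁽ᵃ⁾tr χ̲/tr χ̲)∇⁽ᵃ⁾tr χ̲ + η̲⁽ᵃ⁾tr χ̲²/tr χ̲`": the Leibniz/quotient rule for the horizontal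
gradient as a `V`-valued derivation `G`, `ζ = −η̲`.
[cite: GiorgiKlainermanSzeftel2024, p.860 L45–101; GiorgiKlainermanSzeftel2022, l.35121–35126] -/
theorem C1re_grad (G : Derivation ℤ K V) (xb yb : K) (eb ze : V) (hze : ze = -eb) :
    G (yb ^ 2 / xb) - (yb ^ 2 / xb) • ze
      = -((yb ^ 2 / xb ^ 2) • G xb) + (2 * yb / xb) • G yb + (yb ^ 2 / xb) • eb := by
  subst hze
  rw [div_eq_mul_inv, G.leibniz, G.leibniz_inv, G.leibniz_pow]
  module

/-- "Using (3.4.10), we obtain `∇^(c)(⁽ᵃ⁾tr χ̲²/tr χ̲) = −(⁽ᵃ⁾tr χ̲²/tr χ̲²)(−(3/2)tr χ̲(η̲ + η) − ½⁽ᵃ⁾tr χ̲(*η − *η̲))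
+ (2⁽ᵃ⁾tr χ̲/tr χ̲)(−(3/2)⁽ᵃ⁾tr χ̲(η̲ + η) + ½tr χ̲(*η − *η̲)) + η̲⁽ᵃ⁾tr χ̲²/tr χ̲ + r⁻²Γ_b
= −(⁽ᵃ⁾tr χ̲²/tr χ̲)(½η̲ + (3/2)η) + ½(⁽ᵃ⁾tr χ̲³/tr χ̲²)(*η − *η̲) + ⁽ᵃ⁾tr χ̲(*η − *η̲) + r⁻²Γ_b`" (`tr χ̲ ≠ 0`; the (3.4.10)
values enter with remainders `g1`, `g2`, `Gxb = ∇tr χ̲`, `Gyb = ∇⁽ᵃ⁾tr χ̲`).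
[cite: GiorgiKlainermanSzeftel2024, p.860 L102–157, (3.4.10) p.134 L5–18; GiorgiKlainermanSzeftel2022, l.35127–35132, l.6078–6082] -/
theorem C1re_grad_3410 (xb yb : K) (e eb se seb Gxb Gyb g1 g2 : V) (hxb : xb ≠ 0)
    (hGxb : Gxb = -(3 / 2 * xb) • (eb + e) - (1 / 2 * yb) • (se - seb) + g1)
    (hGyb : Gyb = -(3 / 2 * yb) • (eb + e) + (1 / 2 * xb) • (se - seb) + g2) :
    -((yb ^ 2 / xb ^ 2) • Gxb) + (2 * yb / xb) • Gyb + (yb ^ 2 / xb) • eb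
      = -((yb ^ 2 / xb) • ((1 / 2 : K) • eb + (3 / 2 : K) • e)) + (1 / 2 * (yb ^ 3 / xb ^ 2)) • (se - seb)
        + yb • (se - seb) + (-((yb ^ 2 / xb ^ 2) • g1) + (2 * yb / xb) • g2) := by
  subst hGxb hGyb
  match_scalars <;> (field_simp <;> ring1)

/-- "which implies `∇^(c)(⁽ᵃ⁾tr χ̲²/tr χ̲) + η̲⁽ᵃ⁾tr χ̲²/tr χ̲ = (⁽ᵃ⁾tr χ̲²/tr χ̲)(½η̲ − (3/2)η) + ⁽ᵃ⁾tr χ̲(*η − *η̲) + ½(⁽ᵃ⁾tr χ̲³/tr χ̲²)(*η − *η̲)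
+ r⁻²Γ_b`" (`R` the remainder).
[cite: GiorgiKlainermanSzeftel2024, p.861 L5–36; GiorgiKlainermanSzeftel2022, l.35133–35137] -/
theorem C1re_grad_shift (xb yb : K) (e eb se seb R : V) :
    -((yb ^ 2 / xb) • ((1 / 2 : K) • eb + (3 / 2 : K) • e)) + (1 / 2 * (yb ^ 3 / xb ^ 2)) • (se - seb)
        + yb • (se - seb) + R + (yb ^ 2 / xb) • eb
      = (yb ^ 2 / xb) • ((1 / 2 : K) • eb - (3 / 2 : K) • e) + yb • (se - seb)
        + (1 / 2 * (yb ^ 3 / xb ^ 2)) • (se - seb) + R := by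
  module

/-- "Therefore, if `ℜ(C̃₁) = −2⁽ᵃ⁾tr χ̲²/tr χ̲`, we have `ℜ(Z_{a3}) = 4(∇^(c)(⁽ᵃ⁾tr χ̲²/tr χ̲) + (⁽ᵃ⁾tr χ̲²/tr χ̲)η̲) + 2tr χ̲(η̲ − η)
+ 2⁽ᵃ⁾tr χ̲(*η̲ − 3*η) + r⁻¹Γ_b = 4((⁽ᵃ⁾tr χ̲²/tr χ̲)(½η̲ − (3/2)η) + ⁽ᵃ⁾tr χ̲(*η − *η̲) + ½(⁽ᵃ⁾tr χ̲³/tr χ̲²)(*η − *η̲)) + …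
= 2(⁽ᵃ⁾tr χ̲²/tr χ̲)(η̲ − 3η) + 2(⁽ᵃ⁾tr χ̲³/tr χ̲²)(*η − *η̲) + 2tr χ̲(η̲ − η) − 2⁽ᵃ⁾tr χ̲(*η̲ + *η) + r⁻¹Γ_b`"
(`GCR = ∇^(c)ℜ(C̃₁) = −2∇^(c)(⁽ᵃ⁾tr χ̲²/tr χ̲) = −2Gq`; `hq` is the previous display with remainder `R`).
[cite: GiorgiKlainermanSzeftel2024, p.861 L41–90; GiorgiKlainermanSzeftel2022, l.35138–35146] -/
theorem Za3_Re_final (xb yb CR : K) (e eb se seb GCR Gq R : V) (hCR : CR = -2 * (yb ^ 2 / xb))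
    (hG : GCR = (-2 : K) • Gq)
    (hq : Gq + (yb ^ 2 / xb) • eb = (yb ^ 2 / xb) • ((1 / 2 : K) • eb - (3 / 2 : K) • e) + yb • (se - seb)
        + (1 / 2 * (yb ^ 3 / xb ^ 2)) • (se - seb) + R) :
    (-((2 : K) • GCR) - (2 * CR) • eb + (2 * xb) • (eb - e) + (2 * yb) • (seb - (3 : K) • se)
      = (4 : K) • (Gq + (yb ^ 2 / xb) • eb) + (2 * xb) • (eb - e) + (2 * yb) • (seb - (3 : K) • se)) ∧
    ((4 : K) • (Gq + (yb ^ 2 / xb) • eb) + (2 * xb) • (eb - e) + (2 * yb) • (seb - (3 : K) • se)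
      = (2 * (yb ^ 2 / xb)) • (eb - (3 : K) • e) + (2 * (yb ^ 3 / xb ^ 2)) • (se - seb) + (2 * xb) • (eb - e)
        - (2 * yb) • (seb + se) + (4 : K) • R) := by
  subst hCR hG
  constructor
  · module
  · rw [hq]; module

/-- "Evaluating the above to `e_a = e₁` and using that `η₁ − η̲₁ = Γ_g`, `*η₁ + *η̲₁ = Γ_g`, we obtain
`ℜ(Z₁₃) = −4(⁽ᵃ⁾tr χ̲²/tr χ̲)η̲₁ − 4(⁽ᵃ⁾tr χ̲³/tr χ̲²)*η̲₁ + r⁻¹Γ_b`" — the `e₁`-component with `η₁ = η̲₁`, `*η₁ = −*η̲₁`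
exactly (scalars).
[cite: GiorgiKlainermanSzeftel2024, p.861 L92–99; GiorgiKlainermanSzeftel2022, l.35147–35149] -/
theorem Z13_Re_generic (xb yb e1 b1 se1 sb1 : K) (h1 : e1 = b1) (h2 : se1 = -sb1) :
    2 * (yb ^ 2 / xb) * (b1 - 3 * e1) + 2 * (yb ^ 3 / xb ^ 2) * (se1 - sb1) + 2 * xb * (b1 - e1)
        - 2 * yb * (sb1 + se1)
      = -4 * (yb ^ 2 / xb) * b1 - 4 * (yb ^ 3 / xb ^ 2) * sb1 := by
  subst h1 h2
  ring

omit [CharZero K] in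
/-- "`= −4(⁽ᵃ⁾tr χ̲²/tr χ̲)(−a²sin θ cos θ/|q|³ + (a cos θ/r)(ar sin θ/|q|³)) + r⁻¹Γ_b = r⁻¹Γ_b`": on the outgoing Kerr tables
(`⁽ᵃ⁾tr χ̲/tr χ̲ = −a cos θ/r`, `GRWTransformationAlgebra.atrchb_div_trchb_out`; the bracket is
`GRWTransformationAlgebra.ReZ13_bracket`) the `e₁`-expression vanishes identically.
[cite: GiorgiKlainermanSzeftel2024, p.861 L99–110; GiorgiKlainermanSzeftel2022, l.35149–35150] -/
theorem Z13_Re_kerr (r a m c s n : K) (hn0 : n ≠ 0) (hr : r ≠ 0) (hN : nsq r a c ≠ 0) :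
    -4 * (atrchbO r a m c ^ 2 / trchbO r a m c) * etab1 a c s n
        - 4 * (atrchbO r a m c ^ 3 / trchbO r a m c ^ 2) * setab1 r a s n = 0 := by
  unfold atrchbO trchbO etab1 setab1
  field_simp
  ring

/-- "Evaluating the above to `e_a = e₂` and using that `η₂ + η̲₂ = Γ_g`, `*η₂ − *η̲₂ = Γ_g`:
`ℜ(Z₂₃) = 8(⁽ᵃ⁾tr χ̲²/tr χ̲)η̲₂ + 4tr χ̲ η̲₂ − 4⁽ᵃ⁾tr χ̲*η̲₂ + r⁻¹Γ_b`" — the `e₂`-component with `η₂ = −η̲₂`, `*η₂ = *η̲₂`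
exactly; its outgoing Kerr value `8a sin θ Δ/|q|⁵` is `GRWTransformationAlgebra.Z23_kerr`.
[cite: GiorgiKlainermanSzeftel2024, p.861 L120–150; GiorgiKlainermanSzeftel2022, l.35151–35158] -/
theorem Z23_Re_generic (xb yb e2 b2 se2 sb2 : K) (h1 : e2 = -b2) (h2 : se2 = sb2) :
    2 * (yb ^ 2 / xb) * (b2 - 3 * e2) + 2 * (yb ^ 3 / xb ^ 2) * (se2 - sb2) + 2 * xb * (b2 - e2)
        - 2 * yb * (sb2 + se2)
      = 8 * (yb ^ 2 / xb) * b2 + 4 * xb * b2 - 4 * yb * sb2 := by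
  subst h1 h2
  ring

end Za3Re

/-! ## §8. Kerr provenance of the relations entered as hypotheses (exact outgoing tables of
`GRWTransformationAlgebra`: `tr χ̲ = −2rΔ/|q|⁴`, `⁽ᵃ⁾tr χ̲ = 2aΔcos θ/|q|⁴`, `η₁ = η̲₁ = −a² sin θ cos θ/|q|³`,
`η₂ = −η̲₂ = ar sin θ/|q|³`, `*ξ₁ = ξ₂`, `*ξ₂ = −ξ₁`; `n = |q|`, `c = cos θ`, `s = sin θ`; `e₁ = |q|⁻¹∂_θ` acts through a
derivation `E` with `E r = E a = E m = 0`, `E c = −s`; `div ξ = e₁(ξ₁) + Λξ₁` as in `GRWTransformationAlgebra.div_etab`)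

Lines 1–2 of (3.4.2) are `GRWTransformationAlgebra.id342a_out/id342b`; `∇₄tr χ̲`, `∇₄⁽ᵃ⁾tr χ̲`, `∇₃^(c)tr χ̲` are
`GRWTransformationAlgebra.e4_trchb_out/e4_atrchb_out`, `ZCoefficientLedger.e3c_trchb_out`.  NOT certified here (entered
above only as hypotheses): the `∇₃η` relation of (3.4.8) and the `∇₃^(c)η̲` row of Proposition 2.2.19 (transport of `η`, `η̲` along
`e₃` needs connection data beyond the printed tables), and `[∇₃, *] = 0`. -/

section KerrProvenance

variable {K : Type*} [Field K] [CharZero K]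

omit [CharZero K] in
/-- (3.4.2), lines 3–4: `div(η − η̲) = 0`, `div(*η + *η̲) = 0` exactly — the `e₁`-components `η₁ − η̲₁` and
`*η₁ + *η̲₁ = η₂ + η̲₂` vanish identically, so `e₁(ξ₁) + Λξ₁ = 0` for both.
[cite: GiorgiKlainermanSzeftel2024, (3.4.2) p.129 L140–150, p.857 L5–15; GiorgiKlainermanSzeftel2022, l.5871–5877, l.34993–34996] -/
theorem id342cd (E : Derivation ℤ K K) (r a c s n : K) :
    (1 / n * E (eta1 a c s n - etab1 a c s n) + Lam r a c s n * (eta1 a c s n - etab1 a c s n) = 0) ∧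
    (1 / n * E (seta1 r a s n + setab1 r a s n) + Lam r a c s n * (seta1 r a s n + setab1 r a s n) = 0) := by
  have h1 : eta1 a c s n - etab1 a c s n = 0 := by unfold eta1 etab1; ring
  have h2 : seta1 r a s n + setab1 r a s n = 0 := by unfold seta1 setab1; ring
  rw [h1, h2, map_zero]
  constructor <;> ring

omit [CharZero K] in
/-- (3.4.8), the relation `tr χ̲(η + η̲) + ⁽ᵃ⁾tr χ̲(*η̲ − *η) = 0` (used on p.859 L52 as `= r⁻¹Γ_g`): both components
vanish exactly on the outgoing tables (`e₁`: `tr χ̲(η₁ + η̲₁) + ⁽ᵃ⁾tr χ̲(*η̲₁ − *η₁)`; `e₂`: `η₂ + η̲₂ = 0 = *η̲₂ − *η₂`), and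
on the ingoing ones (`tr χ̲ = −2r/|q|²`, `⁽ᵃ⁾tr χ̲ = 2a cos θ/|q|²`, same `η`, `η̲`).
[cite: GiorgiKlainermanSzeftel2024, (3.4.8) p.133 L85–92, p.124 L55–110, p.127 L130–175; GiorgiKlainermanSzeftel2022, l.6060–6065, l.5554–5566, l.5735–5747] -/
theorem id348_2 (r a m c s n : K) :
    (trchbO r a m c * (eta1 a c s n + etab1 a c s n) + atrchbO r a m c * (setab1 r a s n - seta1 r a s n) = 0) ∧
    (trchbO r a m c * (eta2 r a s n + etab2 r a s n) + atrchbO r a m c * (setab2 a c s n - seta2 a c s n) = 0) ∧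
    (trchbI r a c * (eta1 a c s n + etab1 a c s n) + atrchbI r a c * (setab1 r a s n - seta1 r a s n) = 0) ∧
    (trchbI r a c * (eta2 r a s n + etab2 r a s n) + atrchbI r a c * (setab2 a c s n - seta2 a c s n) = 0) := by
  unfold trchbO atrchbO trchbI atrchbI eta1 etab1 eta2 etab2 seta1 setab1 seta2 setab2
  refine ⟨?_, ?_, ?_, ?_⟩ <;> ring

/-- (3.4.10), `∇tr χ̲ = −(3/2)tr χ̲(η̲ + η) − ½⁽ᵃ⁾tr χ̲(*η − *η̲) + r⁻¹Γ_g`, `∇⁽ᵃ⁾tr χ̲ = −(3/2)⁽ᵃ⁾tr χ̲(η̲ + η) + ½tr χ̲(*η − *η̲) + r⁻¹Γ_g`,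
`e₁`-components (`(∇f)₁ = e₁(f) = |q|⁻¹∂_θ f`), OUTGOING tables: exact.  DIVERGENCE: `[v1]` introduces (3.4.10) inside a
lemma stated "relative to any frame" with the words "We also have" (l.6073), `[J]` with "We also have in the outgoing
null frame" (p.133 L103); the kernel confirms the outgoing statement and refutes the ingoing one (`id3410_in_e1_gap`).
[cite: GiorgiKlainermanSzeftel2024, (3.4.10) p.134 L5–18, p.133 L103, p.127 L130–175; GiorgiKlainermanSzeftel2022, l.6073–6082, l.5735–5747] -/
theorem id3410_out_e1 (E : Derivation ℤ K K) (r a m c s n : K) (hn : n ^ 2 = nsq r a c) (hn0 : n ≠ 0)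
    (hEr : E r = 0) (hEa : E a = 0) (hEm : E m = 0) (hEc : E c = -s) :
    (1 / n * E (trchbO r a m c)
      = -(3 / 2) * trchbO r a m c * (etab1 a c s n + eta1 a c s n)
        - 1 / 2 * atrchbO r a m c * (seta1 r a s n - setab1 r a s n)) ∧
    (1 / n * E (atrchbO r a m c)
      = -(3 / 2) * atrchbO r a m c * (etab1 a c s n + eta1 a c s n)
        + 1 / 2 * trchbO r a m c * (seta1 r a s n - setab1 r a s n)) := by
  obtain ⟨n3, -⟩ := sqpow n _ hn
  have hN := nsq_ne_zero_of_sq r a c n hn hn0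
  obtain ⟨D2, -⟩ := D_num E
  unfold trchbO atrchbO etab1 eta1 seta1 setab1 Del
  simp only [n3]
  unfold nsq at *
  simp only [map_add, map_sub, map_neg, E.leibniz, E.leibniz_pow, E.leibniz_div, hEr, hEa, hEm, hEc, D2,
    smul_eq_mul, nsmul_eq_mul, Nat.cast_ofNat, mul_zero, add_zero, zero_add, sub_zero, smul_zero, neg_zero]
  constructor
  · field_simp
    ring
  · field_simp
    ring

/-- (3.4.10), `e₂`-components: `(∇f)₂ = e₂(f) = 0` for functions of `(r, θ)` ((3.3.3)), and the right sides vanish since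
`η₂ + η̲₂ = 0`, `*η₂ − *η̲₂ = 0` — in any frame (`X`, `Y` arbitrary coefficients).
[cite: GiorgiKlainermanSzeftel2024, (3.4.10) p.134 L5–18, (3.3.3) p.123 L60–77; GiorgiKlainermanSzeftel2022, l.6078–6082, l.5491] -/
theorem id3410_e2 (X Y r a c s n : K) :
    (-(3 / 2) * X * (etab2 r a s n + eta2 r a s n) - 1 / 2 * Y * (seta2 a c s n - setab2 a c s n) = 0) ∧
    (-(3 / 2) * X * (etab2 r a s n + eta2 r a s n) + 1 / 2 * Y * (seta2 a c s n - setab2 a c s n) = 0) := by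
  unfold etab2 eta2 seta2 setab2
  constructor <;> ring

/-- (3.4.10), `e₁`-components on the INGOING tables (`tr χ̲ = −2r/|q|²`, `⁽ᵃ⁾tr χ̲ = 2a cos θ/|q|²`, same `η`, `η̲`): the
two sides differ by `4a²r cos θ sin θ/|q|⁵` and `−4a³cos²θ sin θ/|q|⁵` — nonzero for `a ≠ 0`; (3.4.10) is an
outgoing-frame statement, as `[J]` p.133 L103 says and `[v1]` l.6073 does not.
[cite: GiorgiKlainermanSzeftel2024, (3.4.10) p.134 L5–18, p.133 L103, p.124 L55–110; GiorgiKlainermanSzeftel2022, l.6073–6082, l.5554–5566] -/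
theorem id3410_in_e1_gap (E : Derivation ℤ K K) (r a c s n : K) (hn : n ^ 2 = nsq r a c) (hn0 : n ≠ 0)
    (hEr : E r = 0) (hEa : E a = 0) (hEc : E c = -s) :
    (1 / n * E (trchbI r a c)
        - (-(3 / 2) * trchbI r a c * (etab1 a c s n + eta1 a c s n)
            - 1 / 2 * atrchbI r a c * (seta1 r a s n - setab1 r a s n))
      = 4 * a ^ 2 * r * c * s / n ^ 5) ∧
    (1 / n * E (atrchbI r a c)
        - (-(3 / 2) * atrchbI r a c * (etab1 a c s n + eta1 a c s n)
            + 1 / 2 * trchbI r a c * (seta1 r a s n - setab1 r a s n))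
      = -(4 * a ^ 3 * c ^ 2 * s) / n ^ 5) := by
  obtain ⟨n3, -, n5, -⟩ := sqpow n _ hn
  have hN := nsq_ne_zero_of_sq r a c n hn hn0
  obtain ⟨D2, -⟩ := D_num E
  unfold trchbI atrchbI etab1 eta1 seta1 setab1
  simp only [n3, n5]
  unfold nsq at *
  simp only [map_add, map_neg, E.leibniz, E.leibniz_pow, E.leibniz_div, hEr, hEa, hEc, D2,
    smul_eq_mul, nsmul_eq_mul, Nat.cast_ofNat, mul_zero, add_zero, zero_add, smul_zero, neg_zero]
  constructor
  · field_simp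
    ring
  · field_simp
    ring

omit [CharZero K] in
/-- The `⁽ᵃ⁾tr χ̲` twin of `ZCoefficientLedger.e3c_trchb_out`: with `e₃ = −(Δ/|q|²)∂ᵣ` on functions of `(r, cos θ)` and
`∇₃^(c) = ∇₃ + 2ω̲` on the `(−1)`-conformal `⁽ᵃ⁾tr χ̲`, `e₃(⁽ᵃ⁾tr χ̲) + 2ω̲⁽ᵃ⁾tr χ̲ = −tr χ̲⁽ᵃ⁾tr χ̲` for all `a`
(Proposition 2.2.19, `∇₃^(c)⁽ᵃ⁾tr χ̲ + tr χ̲⁽ᵃ⁾tr χ̲ = −χ̲̂ ∧ χ̲̂ + 2curl^(c)ξ̲ + 2ξ̲ ∧ (η̲ − η)`, with `χ̲̂ = ξ̲ = 0` in Kerr) —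
the fact behind "`ℑ(Z₄₃) = r⁻¹Γ_b` if `ℑ(C̃₁) = n⁽ᵃ⁾tr χ̲`".
[cite: GiorgiKlainermanSzeftel2024, Proposition 2.2.19 p.105 L23, p.126 L67–95, p.127 L130–175, p.858 L14–16; GiorgiKlainermanSzeftel2022, l.4584, l.5683–5687, l.5735–5747, l.35026] -/
theorem e3c_atrchb_out (D : Derivation ℤ K K) (r a m c : K) (hN : nsq r a c ≠ 0)
    (hDr : D r = -(Del r a m / nsq r a c)) (hDa : D a = 0) (hDm : D m = 0) (hDc : D c = 0) :
    D (atrchbO r a m c) + 2 * ombO r a m c * atrchbO r a m c = -(trchbO r a m c * atrchbO r a m c) := by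
  obtain ⟨D2, -⟩ := D_num D
  unfold trchbO atrchbO ombO Del at *
  unfold nsq at *
  simp only [map_add, map_sub, D.leibniz, D.leibniz_pow, D.leibniz_div, hDr, hDa, hDm, hDc, D2,
    smul_eq_mul, nsmul_eq_mul, Nat.cast_ofNat, mul_zero, add_zero, smul_zero] at *
  field_simp
  ring

omit [CharZero K] in
/-- `ℑ(Z₄₃) = 0` exactly for `ℑ(C̃₁) = nn⁽ᵃ⁾tr χ̲`, `nn` constant, on the outgoing tables (`Z43_Im_n` with
`e3c_atrchb_out`).
[cite: GiorgiKlainermanSzeftel2024, p.858 L12–16; GiorgiKlainermanSzeftel2022, l.35023–35026] -/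
theorem kerr_Z43_Im (D : Derivation ℤ K K) (r a m c nn : K) (hN : nsq r a c ≠ 0)
    (hDr : D r = -(Del r a m / nsq r a c)) (hDa : D a = 0) (hDm : D m = 0) (hDc : D c = 0) (hDn : D nn = 0) :
    (D (nn * atrchbO r a m c) + 2 * ombO r a m c * (nn * atrchbO r a m c)) + trchbO r a m c * (nn * atrchbO r a m c)
      = 0 := by
  have h := e3c_atrchb_out D r a m c hN hDr hDa hDm hDc
  rw [D.leibniz, hDn, smul_eq_mul, smul_eq_mul, mul_zero, add_zero]
  linear_combination nn * h

/-- (D.4.19) holds exactly for `ℑ(C̃₁) = −4⁽ᵃ⁾tr χ̲` on the outgoing tables: `ω = 0` there (`[J]` p.127), so `∇₄^(c) = e₄ = ∂ᵣ`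
on functions of `(r, θ)`, and `e₄(−4⁽ᵃ⁾tr χ̲) = −8*ρ − 8curl η̲` (`curl η̲ = div *η̲`), by
`GRWTransformationAlgebra.e4_atrchb_out` and the first (3.4.2) relation `GRWTransformationAlgebra.id342a_out`.
[cite: GiorgiKlainermanSzeftel2024, (D.4.19) p.855 L15–24, p.127 L130–175; GiorgiKlainermanSzeftel2022, l.34930–34935, l.5735–5747] -/
theorem kerr_D419 (D : Derivation ℤ K K) (r a m c : K) (hN : nsq r a c ≠ 0)
    (hDr : D r = 1) (hDa : D a = 0) (hDm : D m = 0) (hDc : D c = 0) :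
    D (-4 * atrchbO r a m c) = -8 * srho r a m c - 8 * curlEtab r a c := by
  have h1 := e4_atrchb_out D r a m c hN hDr hDa hDm hDc
  have h2 := id342a_out r a m c
  obtain ⟨-, -, D4, -⟩ := D_num D
  rw [show (-4 : K) * atrchbO r a m c = -(4 * atrchbO r a m c) by ring, map_neg, D.leibniz, D4, smul_eq_mul,
    smul_eq_mul, mul_zero, add_zero, h1]
  linear_combination (2 : K) * h2

end KerrProvenance

/-! ## §9. The frame identity behind `L_𝔮` (`[J]` p.863 L32–52 = `[v1]` l.35218–35222)

"`2Z₄₃T∇₃ + ℜ(Z)^a∇_a∇₃ = Z₄₃((|q|²/Δ)e₃ + e₄)∇₃ + Z₂₃e₂∇₃ + l.o.t.`" and the collection of the `∇_T`, `∇_Z` coefficients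
(p.863 L52–88) continue in `GRWTransformationAlgebra.Lq_coefficients` and `GRWTransformationAlgebra.V_eq_V1_add_Z43`. -/

section Lq

variable {K : Type*} [Field K] [CharZero K]

/-- "`½((Δ/(r² + a²))e₄ + (|q|²/(r² + a²))e₃) = ∂ₜ + (a/(r² + a²))∂_φ = T̂`": outgoing pair
`e₄ = ((r² + a²)/Δ)∂ₜ + ∂ᵣ + (a/Δ)∂_φ`, `e₃ = ((r² + a²)∂ₜ − Δ∂ᵣ + a∂_φ)/|q|²`, componentwise over `(∂ₜ, ∂ᵣ, ∂_φ)`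
(`N = |q|²`) — equivalently the decompositions `e₄ = ((r² + a²)/Δ)(T̂ + (Δ/(r² + a²))∂ᵣ)`,
`e₃ = ((r² + a²)/|q|²)(T̂ − (Δ/(r² + a²))∂ᵣ)` of `[J]` p.127 L5–40.
[cite: GiorgiKlainermanSzeftel2024, p.863 L32–52, p.126 L67–95, p.127 L5–40, p.123 L81; GiorgiKlainermanSzeftel2022, l.35218–35222, l.5683–5687, l.5497] -/
theorem That_from_null_pair_out (r a m N : K) (hD : Del r a m ≠ 0) (hN : N ≠ 0) (hra : r ^ 2 + a ^ 2 ≠ 0) :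
    (1 / 2 * (Del r a m / (r ^ 2 + a ^ 2) * ((r ^ 2 + a ^ 2) / Del r a m)
        + N / (r ^ 2 + a ^ 2) * ((r ^ 2 + a ^ 2) / N)) = 1) ∧
    (1 / 2 * (Del r a m / (r ^ 2 + a ^ 2) * 1 + N / (r ^ 2 + a ^ 2) * (-(Del r a m / N))) = 0) ∧
    (1 / 2 * (Del r a m / (r ^ 2 + a ^ 2) * (a / Del r a m) + N / (r ^ 2 + a ^ 2) * (a / N))
        = a / (r ^ 2 + a ^ 2)) := by
  refine ⟨?_, ?_, ?_⟩
  · field_simp; ring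
  · field_simp; ring
  · field_simp; ring

omit [CharZero K] in
/-- The `∂ₜ`, `∂ᵣ`, `∂_φ` components of `Z₄₃((|q|²/Δ)e₃ + e₄) + Z₂₃e₂` with `e₂ = (a sin θ/|q|)∂ₜ + (1/(|q| sin θ))∂_φ`
((3.3.3)): "`= −qq̄³[2Z₄₃(((r² + a²)/Δ)∇_T + (a/Δ)∇_Z)∇₃A + Z₂₃((a sin θ/|q|)∇_T + (1/(|q| sin θ))∇_Z)∇₃A] + …`"; the two
resulting coefficients are evaluated in `GRWTransformationAlgebra.Lq_coefficients` (`z43`, `z23` arbitrary here).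
[cite: GiorgiKlainermanSzeftel2024, p.863 L52–88, (3.3.3) p.123 L60–77; GiorgiKlainermanSzeftel2022, l.35223–35231, l.5491] -/
theorem Lq_collect (z43 z23 r a m N n s : K) (hD : Del r a m ≠ 0) (hN : N ≠ 0) :
    (z43 * (N / Del r a m * ((r ^ 2 + a ^ 2) / N) + (r ^ 2 + a ^ 2) / Del r a m) + z23 * (a * s / n)
      = 2 * z43 * (r ^ 2 + a ^ 2) / Del r a m + z23 * (a * s / n)) ∧
    (z43 * (N / Del r a m * (-(Del r a m / N)) + 1) + z23 * 0 = 0) ∧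
    (z43 * (N / Del r a m * (a / N) + a / Del r a m) + z23 * (1 / (n * s))
      = 2 * z43 * a / Del r a m + z23 * (1 / (n * s))) := by
  refine ⟨?_, ?_, ?_⟩
  · field_simp; ring
  · field_simp; ring
  · field_simp; ring

end Lq

end Literature.Geometry.Lorentzian.GiorgiKlainermanSzeftel2022.PotentialRealityLedger
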